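import Mathlib
import Literature.Combinatorics.Optimization.PentagonsPsdRankFour
import Literature.ModelTheory.ExponentialFields.SemialgebraicInterior
import Literature.NumberTheory.Transcendental.SemialgebraicMapsProofs
import Literature.LinearAlgebra.Matrix.CharpolySignAlternation
import Literature.RingTheory.NoetherNormalization.GenericLinearForms
import Literature.Barriers.PneNP.TSPExtensionComplexity
import Literature.LinearAlgebra.Matrix.SymmetricMatrixCongruence
import HarnessLib

/-!
# Generic polytopes have psd rank at least `(nv)^{1/4}` (Gouveia–Robinson–Thomas 2015, Theorem 2.1)
# and extension complexity at least `√(nv)` (Fiorini–Rothvoß–Tiwary 2012, Theorem 3)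

Source. J. Gouveia, R. Z. Robinson, R. R. Thomas, *Worst-case results for positive semidefinite
rank*, Math. Program. 153 (2015) 201–212 = arXiv:1305.4600 [GouveiaRobinsonThomas2015], §2,
Theorem 2.1 (held text `paper:arxiv-1305.4600`, p05, statement and complete proof): "If `P ⊂ ℝⁿ` is
a generic polytope with `v` vertices, then its psd rank is at least `(nv)^{1/4}`", a polytope being
*generic* when "the coordinates of its vertices form an algebraically independent set over the
rationals". This is the lower-bound technique for psd rank recorded in the survey H. Fawzi,
J. Gouveia, P. A. Parrilo, R. Z. Robinson, R. R. Thomas, *Positive semidefinite rank*,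
Math. Program. 153 (2015) [FawziEtAl2015], §5.2 (p17: "Gouveia et. al. produced a lower bound for
generic polytopes (polytopes whose vertices are algebraically independent)"). The tree types the
theorem as the NAMED FACT `GouveiaRobinsonThomas2015_thm21` (`PentagonsPsdRankFour.lean`, with the
full-dimensionality hypothesis the printed projection form presupposes); this file DISCHARGES it:
`GouveiaRobinsonThomas2015_thm21_holds`.

## The printed proof and the proof given here

Printed proof (p05). (a) "Without loss of generality … this linear map is the projection onto the
first `n` coordinates": `P = {x ∈ ℝⁿ | ∃ x_{n+1..d_k−1}, Σ x_i G_i + G_{d_k} ⪰ 0}`, so that the lift is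
given by at most `d_k² ≤ k⁴` real numbers `Γ` (`d_k = k(k+1)/2`). (b) Every vertex `p` of `P` is the
unique optimum of a linear program with rational objective; lifting it to a semidefinite program
satisfying Slater's condition, the first-order optimality conditions are polynomial (in)equalities
with coefficients in `ℚ(Γ)`, so by the Tarski–Seidenberg theorem they have a solution over the real
closure of `ℚ(Γ)`: the vertex coordinates are algebraic over `ℚ(Γ)`. (c) `nv` algebraically
independent numbers algebraic over a field generated by `|Γ|` elements force `nv ≤ |Γ| ≤ k⁴`.

This file follows (a)–(c) with one DEVIATION in (b): instead of semidefinite duality we use the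
Tarski–Seidenberg theorem *with the lift data as additional variables* over the coefficient field
`ℚ` (the tree's PROVED `Literature.ModelTheory.ExponentialFields.tarski_seidenberg_real_holds`,
through `IsSemialgebraic.image_castAdd` / `image_comp` / `preimage_comp`). The family of all
normal-form lifts `𝒰 = {(θ, x) | ∃ u, G₀(θ) + Σ x_l G_l(θ) + Σ u_j G'_j(θ) ⪰ 0}` is `ℚ`-semialgebraic
(psd-ness through the tree's sign test on characteristic coefficients,
`Literature.LinearAlgebra.Matrix.CharpolySignAlternation`), hence so is the set of optima of a
rational functional and its coordinate images; and a point `t₀` whose fibre `{t | (t, θ₀) ∈ W}` in a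
`ℚ`-semialgebraic `W` is finite is algebraic over `ℚ[θ₀]` (`GenericPsdRank.isAlgebraic_of_fibre_finite`,
the parametric form of the tree's `SemialgebraicAlgebraicPoints.isAlgebraic_of_mem_of_finite`:
a transcendental point is generic for sets defined over `ℚ[θ₀]`). No Slater point or properness of
the lift is needed. Step (a) is `GenericPsdRank.exists_normalForm` (the count `1 + n + m ≤ k²`,
hence `(1 + n + m)·k² ≤ k⁴` parameters: for `k ≥ 2` because the symmetric part of the direction of
`L` is a proper subspace of the `k × k` matrices; `k ≤ 1` is impossible for a bounded full-dimensional
`C ⊆ ℝⁿ`, `n ≥ 1`); step (c) is Mathlib's `AlgebraicIndependent.cardinalMk_le_trdeg` with the tree's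
`Literature.RingTheory.NoetherNormalization.trdeg_adjoin_le_of_forall_isAlgebraic`.

Contents (everything PROVED; no named fact is introduced): §1 generic fibres
(`fibre_mem_nhds_or_compl_mem_nhds`, `isAlgebraic_of_fibre_finite`); §2 the universal family
(`isSemialgebraic_setOf_posSemidef`, `liftFamily`, `optSet`, `coordSet`,
`isAlgebraic_of_unique_optimum`); §3 the normal form (`exists_normalForm`); §4 vertices are exposed by
rational functionals (`exists_rat_strict`, `eq_of_isMax_dotRat`); §5 the discharge; §6 (appended) the
LP ANALOGUE the printed proof adapts — S. Fiorini, T. Rothvoß, H. R. Tiwary, *Extended formulations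
for polygons*, Discrete Comput. Geom. 48 (2012) 658–668 = arXiv:1107.0371 [FioriniRothvossTiwary2012],
§4 Theorem 3 (held text `paper:arxiv-1107.0371`, p07: "If `P` is a generic convex `n`-gon in `ℝ²`
then `xc(P) ≥ √(2n)`") and the GRT remark (p05) "the nonnegative rank of a generic `n`-dimensional
polytope with `v` vertices is at least `√(nv)`": `FioriniRothvossTiwary2012_thm3`,
`GouveiaRobinsonThomas2015_xc_generic`, for the tree's slack-form extended formulations
`Literature.Barriers.PneNP.HasEFOfSize`, through the abstract optimum machinery
`GenericPsdRank.isAlgebraic_of_unique_optimum_of_family` (any `ℚ`-semialgebraic family) and the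
normal form `GenericPsdRank.exists_lpNormalForm` (`1 + n + m ≤ r` vectors of `ℝ^r`); §7 (appended) the
printed intermediate count `nv ≤ |Γ| ≤ d_k²`, `d_k = C(k+1,2) = k(k+1)/2` — the normal form with
SYMMETRIC matrices and `1 + n + m ≤ d_k` (`GenericPsdRank.exists_normalForm_symm`: the symmetric part of
the direction of `L` is a proper subspace of `Sym_k` — the tree's
`Literature.LinearAlgebra.Matrix.symmetricSubmodule`, `finrank_symmetricSubmodule_eq_choose` — since every
symmetric matrix is a difference of two psd ones), parametrised by upper-triangular entries, giving
`GouveiaRobinsonThomas2015_thm21_sharp`: `√(nv) ≤ C(k+1,2)`.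

## References
* [GouveiaRobinsonThomas2015] J. Gouveia, R. Z. Robinson, R. R. Thomas, Math. Program. 153 (2015),
  Thm. 2.1 (arXiv:1305.4600, p05).
* [FawziEtAl2015] H. Fawzi, J. Gouveia, P. A. Parrilo, R. Z. Robinson, R. R. Thomas, Math. Program.
  153 (2015), §5.2 (arXiv:1407.4095, p17).
* [FioriniRothvossTiwary2012] S. Fiorini, T. Rothvoß, H. R. Tiwary, Discrete Comput. Geom. 48
  (2012), Thm. 3 (arXiv:1107.0371, p07).
* [BochnakCosteRoy1998] J. Bochnak, M. Coste, M.-F. Roy, *Real Algebraic Geometry*, Thm. 2.2.1.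
* [BlekhermanParriloThomas2012] G. Blekherman, P. A. Parrilo, R. R. Thomas (eds.), *Semidefinite
  Optimization and Convex Algebraic Geometry*, Prop. A.1.
-/

noncomputable section

open Set Filter Topology
open scoped Matrix
open Literature.ModelTheory.ExponentialFields

namespace Literature.Combinatorics.Optimization

namespace GenericPsdRank

/-! ### §1 Generic fibres: definable points are algebraic over the parameters -/

section Fibres

variable {N : ℕ}

/-- The subring `ℚ[θ_0, …, θ_{N-1}] ⊆ ℝ` generated by the coordinates of a parameter point `θ`.
[folklore] -/
abbrev paramRing (θ : Fin N → ℝ) : Subalgebra ℚ ℝ := Algebra.adjoin ℚ (Set.range θ)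

/-- The coordinate `θ_j` as an element of `ℚ[θ]`. [folklore] -/
def paramElt (θ : Fin N → ℝ) (j : Fin N) : paramRing θ :=
  ⟨θ j, Algebra.subset_adjoin ⟨j, rfl⟩⟩

/-- The coordinate element coerces back to the coordinate. [folklore] -/
@[simp] private theorem coe_paramElt (θ : Fin N → ℝ) (j : Fin N) : (paramElt θ j : ℝ) = θ j := rfl

/-- The substitution `t ↦ X`, `θ_j ↦ θ_j ∈ ℚ[θ]`. [folklore] -/
def specVars (θ : Fin N → ℝ) : Fin (N + 1) → Polynomial (paramRing θ) :=
  Fin.cons Polynomial.X fun j => Polynomial.C (paramElt θ j)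

/-- Specialisation of a rational polynomial `p(t, θ)` at the parameter point `θ`: the one-variable
polynomial `p(·, θ) ∈ ℚ[θ][t]`. [folklore] -/
def specialize (θ : Fin N → ℝ) (p : MvPolynomial (Fin (N + 1)) ℚ) : Polynomial (paramRing θ) :=
  MvPolynomial.aeval (specVars θ) p

/-- `p(·, θ)` evaluated at `t` is `p(t, θ)`. [folklore] -/
private theorem aeval_specialize (θ : Fin N → ℝ) (p : MvPolynomial (Fin (N + 1)) ℚ) (t : ℝ) :
    Polynomial.aeval t (specialize θ p) =
      MvPolynomial.aeval (Fin.cons t θ : Fin (N + 1) → ℝ) p := by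
  have h := MvPolynomial.comp_aeval (R := ℚ) (f := specVars θ)
    ((Polynomial.aeval (R := paramRing θ) t).restrictScalars ℚ)
  have h2 := AlgHom.congr_fun h p
  simp only [AlgHom.comp_apply, AlgHom.restrictScalars_apply] at h2
  have hf : (fun i => Polynomial.aeval (R := paramRing θ) t (specVars θ i)) =
      (Fin.cons t θ : Fin (N + 1) → ℝ) := by
    funext i
    refine Fin.cases ?_ (fun j => ?_) i
    · simp [specVars]
    · simp [specVars, Polynomial.aeval_C]
  rw [specialize, h2, hf]

/-- `t ↦ p(t, θ)` is continuous. [folklore] -/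
private theorem continuous_aeval_cons (θ : Fin N → ℝ) (p : MvPolynomial (Fin (N + 1)) ℚ) :
    Continuous fun t : ℝ => MvPolynomial.aeval (Fin.cons t θ : Fin (N + 1) → ℝ) p := by
  refine (continuous_aeval_real p).comp ?_
  refine continuous_pi fun i => ?_
  refine Fin.cases ?_ (fun j => ?_) i
  · simp only [Fin.cons_zero]
    exact continuous_id
  · simp only [Fin.cons_succ]
    exact continuous_const

/-- **Generic fibres.** If `t₀` is transcendental over `ℚ[θ]`, then for every `ℚ`-semialgebraic
`W ⊆ ℝ^{N+1}` the fibre `{t | (t, θ) ∈ W}` is a neighbourhood of `t₀` or is disjoint from a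
neighbourhood of `t₀`: every generating sign condition `p(t, θ) = 0` / `p(t, θ) > 0` is either
constant in `t` (when `p(·, θ) = 0 ∈ ℚ[θ][t]`) or decided near `t₀` by continuity (a non-zero
`p(·, θ)` does not vanish at the transcendental `t₀`), and the property passes to Boolean
combinations (Tarski–Seidenberg with parameters: definable points are algebraic over the
parameters — the step "by the Tarski–Seidenberg Theorem … there exists a solution … over the real
closure of `ℚ(Γ)`" of the printed proof). [cite: GouveiaRobinsonThomas2015, Thm. 2.1 proof (p05)]
[cite: BochnakCosteRoy1998, Thm. 2.2.1] -/
theorem fibre_mem_nhds_or_compl_mem_nhds {θ : Fin N → ℝ} {t₀ : ℝ}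
    (ht : Transcendental (paramRing θ) t₀) {W : Set (Fin (N + 1) → ℝ)}
    (hW : IsSemialgebraic ℚ W) :
    {t : ℝ | (Fin.cons t θ : Fin (N + 1) → ℝ) ∈ W} ∈ 𝓝 t₀ ∨
      {t : ℝ | (Fin.cons t θ : Fin (N + 1) → ℝ) ∈ W}ᶜ ∈ 𝓝 t₀ := by
  have hne : ∀ q : Polynomial (paramRing θ), q ≠ 0 → Polynomial.aeval t₀ q ≠ 0 :=
    fun q hq h => ht ⟨q, hq, h⟩
  induction hW using BooleanSubalgebra.closure_bot_sup_induction with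
  | mem s hs =>
    rcases hs with ⟨p, rfl⟩ | ⟨p, rfl⟩
    · by_cases hq : specialize θ p = 0
      · left
        have h0 : ∀ t : ℝ, MvPolynomial.aeval (Fin.cons t θ : Fin (N + 1) → ℝ) p = 0 := fun t => by
          rw [← aeval_specialize, hq, map_zero]
        exact Filter.univ_mem' fun t => by simp [h0 t]
      · right
        have h0 : MvPolynomial.aeval (Fin.cons t₀ θ : Fin (N + 1) → ℝ) p ≠ 0 := by
          rw [← aeval_specialize]; exact hne _ hq
        have hopen : IsOpen {t : ℝ | MvPolynomial.aeval (Fin.cons t θ : Fin (N + 1) → ℝ) p ≠ 0} :=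
          isOpen_ne_fun (continuous_aeval_cons θ p) continuous_const
        have hmem := hopen.mem_nhds h0
        simpa [compl_setOf] using hmem
    · by_cases hq : specialize θ p = 0
      · right
        have h0 : ∀ t : ℝ, MvPolynomial.aeval (Fin.cons t θ : Fin (N + 1) → ℝ) p = 0 := fun t => by
          rw [← aeval_specialize, hq, map_zero]
        exact Filter.univ_mem' fun t => by simp [h0 t]
      · have h0 : MvPolynomial.aeval (Fin.cons t₀ θ : Fin (N + 1) → ℝ) p ≠ 0 := by
          rw [← aeval_specialize]; exact hne _ hq
        rcases lt_or_gt_of_ne h0 with hlt | hgt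
        · right
          have hopen : IsOpen {t : ℝ | MvPolynomial.aeval (Fin.cons t θ : Fin (N + 1) → ℝ) p < 0} :=
            isOpen_lt (continuous_aeval_cons θ p) continuous_const
          filter_upwards [hopen.mem_nhds hlt] with t ht'
          simp only [mem_compl_iff, mem_setOf_eq, not_lt]
          exact le_of_lt ht'
        · left
          exact (isOpen_lt continuous_const (continuous_aeval_cons θ p)).mem_nhds hgt
  | bot =>
    right
    simp
  | sup s _ u _ ihs ihu =>
    rcases ihs with hs | hs
    · exact Or.inl (mem_of_superset hs fun t ht' => Or.inl ht')
    · rcases ihu with hu | hu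
      · exact Or.inl (mem_of_superset hu fun t ht' => Or.inr ht')
      · right
        filter_upwards [hs, hu] with t h1 h2
        simp only [mem_compl_iff, mem_setOf_eq] at h1 h2 ⊢
        exact fun h => h.elim h1 h2
  | compl s _ ihs =>
    rcases ihs with hs | hs
    · right
      simpa only [compl_setOf, mem_compl_iff, not_not] using hs
    · left
      simpa only [compl_setOf, mem_compl_iff] using hs

/-- A point whose fibre is neither a neighbourhood nor a co-neighbourhood is algebraic over the
parameters. [cite: GouveiaRobinsonThomas2015, Thm. 2.1 proof (p05)] [cite: BochnakCosteRoy1998, Thm. 2.2.1] -/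
theorem isAlgebraic_of_fibre {θ : Fin N → ℝ} {t₀ : ℝ} {W : Set (Fin (N + 1) → ℝ)}
    (hW : IsSemialgebraic ℚ W) (h₁ : {t : ℝ | (Fin.cons t θ : Fin (N + 1) → ℝ) ∈ W} ∉ 𝓝 t₀)
    (h₂ : {t : ℝ | (Fin.cons t θ : Fin (N + 1) → ℝ) ∈ W}ᶜ ∉ 𝓝 t₀) :
    IsAlgebraic (paramRing θ) t₀ := by
  by_contra h
  rcases fibre_mem_nhds_or_compl_mem_nhds h hW with h' | h'
  · exact h₁ h'
  · exact h₂ h'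

/-- **Points of finite fibres are algebraic over the parameters** ("the coordinates `p_1, …, p_n` are
contained in `\overline{ℚ(Γ)}`"). [cite: GouveiaRobinsonThomas2015, Thm. 2.1 proof (p05)]
[cite: BochnakCosteRoy1998, Thm. 2.2.1] -/
theorem isAlgebraic_of_fibre_finite {θ : Fin N → ℝ} {t₀ : ℝ} {W : Set (Fin (N + 1) → ℝ)}
    (hW : IsSemialgebraic ℚ W) (hfin : {t : ℝ | (Fin.cons t θ : Fin (N + 1) → ℝ) ∈ W}.Finite)
    (ht₀ : (Fin.cons t₀ θ : Fin (N + 1) → ℝ) ∈ W) : IsAlgebraic (paramRing θ) t₀ :=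
  isAlgebraic_of_fibre hW (fun h => (infinite_of_mem_nhds t₀ h) hfin)
    fun h => (mem_of_mem_nhds h) ht₀

end Fibres

/-! ### §2 The universal family of psd lifts

#### Psd-ness of a symbolic matrix is a `ℚ`-semialgebraic condition -/

section PsdSemialgebraic

variable {ι : Type*} {k : ℕ}

open Literature.LinearAlgebra.Matrix.CharpolySignAlternation
  (posSemidef_iff_sign_mul_charpoly_coeff_nonneg_real)

/-- The characteristic polynomial of the evaluation of a symbolic matrix is the evaluation of its
symbolic characteristic polynomial. [folklore] -/
private theorem charpoly_map_aeval_coeff (𝕄 : Matrix (Fin k) (Fin k) (MvPolynomial ι ℚ)) (w : ι → ℝ)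
    (i : ℕ) : (𝕄.map (MvPolynomial.aeval w)).charpoly.coeff i =
      MvPolynomial.aeval w (𝕄.charpoly.coeff i) := by
  have h1 := Matrix.charpoly_map 𝕄 (MvPolynomial.aeval w).toRingHom
  rw [AlgHom.toRingHom_eq_coe, RingHom.coe_coe] at h1
  rw [h1, Polynomial.coeff_map, RingHom.coe_coe]

/-- **Psd-ness is a `ℚ`-semialgebraic condition.** For a matrix `𝕄` of rational polynomials,
`{w | 𝕄(w) ⪰ 0}` is `ℚ`-semialgebraic: symmetry is a system of polynomial equations and, for
symmetric real matrices, `A ⪰ 0 ↔ (−1)^{k−i} coeff_i(χ_A) ≥ 0` for `i ≤ k` (the tree's Descartes /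
Horn–Johnson sign test). [cite: BlekhermanParriloThomas2012, Prop. A.1 (5)] -/
theorem isSemialgebraic_setOf_posSemidef (𝕄 : Matrix (Fin k) (Fin k) (MvPolynomial ι ℚ)) :
    IsSemialgebraic ℚ {w : ι → ℝ | (𝕄.map (MvPolynomial.aeval w)).PosSemidef} := by
  classical
  have hsym : IsSemialgebraic ℚ {w : ι → ℝ | (𝕄.map (MvPolynomial.aeval w)).IsSymm} := by
    have heq : {w : ι → ℝ | (𝕄.map (MvPolynomial.aeval w)).IsSymm} =
        ⋂ a ∈ (Finset.univ : Finset (Fin k)), ⋂ b ∈ (Finset.univ : Finset (Fin k)),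
          {w : ι → ℝ | MvPolynomial.aeval w (𝕄 b a - 𝕄 a b) = 0} := by
      ext w
      simp only [mem_setOf_eq, mem_iInter, Finset.mem_univ, true_implies, Matrix.IsSymm.ext_iff,
        Matrix.map_apply, map_sub, sub_eq_zero]
    rw [heq]
    exact IsSemialgebraic.biInter _ _ fun a _ => IsSemialgebraic.biInter _ _ fun b _ =>
      isSemialgebraic_setOf_eval_eq_zero _
  have hcoef : ∀ i : ℕ, IsSemialgebraic ℚ
      {w : ι → ℝ | 0 ≤ (-1 : ℝ) ^ (k - i) * (𝕄.map (MvPolynomial.aeval w)).charpoly.coeff i} := by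
    intro i
    have heq : {w : ι → ℝ | 0 ≤ (-1 : ℝ) ^ (k - i) * (𝕄.map (MvPolynomial.aeval w)).charpoly.coeff i} =
        {w : ι → ℝ | 0 ≤ MvPolynomial.aeval w
          (MvPolynomial.C ((-1 : ℚ) ^ (k - i)) * 𝕄.charpoly.coeff i)} := by
      ext w
      rw [mem_setOf_eq, mem_setOf_eq, charpoly_map_aeval_coeff, map_mul, MvPolynomial.aeval_C]
      simp
    rw [heq]
    exact isSemialgebraic_setOf_eval_nonneg _
  have heq : {w : ι → ℝ | (𝕄.map (MvPolynomial.aeval w)).PosSemidef} =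
      {w | (𝕄.map (MvPolynomial.aeval w)).IsSymm} ∩ ⋂ i ∈ Finset.range (k + 1),
        {w | 0 ≤ (-1 : ℝ) ^ (k - i) * (𝕄.map (MvPolynomial.aeval w)).charpoly.coeff i} := by
    ext w
    simp only [mem_setOf_eq, mem_inter_iff, mem_iInter, Finset.mem_range]
    constructor
    · intro h
      have hs : (𝕄.map (MvPolynomial.aeval w)).IsSymm := Matrix.isHermitian_iff_isSymm.1 h.1
      refine ⟨hs, fun i _ => ?_⟩
      have := (posSemidef_iff_sign_mul_charpoly_coeff_nonneg_real hs).1 h i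
      simpa [Fintype.card_fin] using this
    · rintro ⟨hs, h⟩
      refine (posSemidef_iff_sign_mul_charpoly_coeff_nonneg_real hs).2 fun i => ?_
      rw [Fintype.card_fin]
      by_cases hi : i < k + 1
      · exact h i hi
      · have h0 : (𝕄.map (MvPolynomial.aeval w)).charpoly.coeff i = 0 := by
          apply Polynomial.coeff_eq_zero_of_natDegree_lt
          rw [Matrix.charpoly_natDegree_eq_dim, Fintype.card_fin]
          omega
        rw [h0, mul_zero]
  rw [heq]
  exact hsym.inter (IsSemialgebraic.biInter _ _ fun i _ => hcoef i)

end PsdSemialgebraic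

/-! #### The universal pencil and the lift family -/

section Pencil

variable {c k : ℕ}

/-- Position of the entry `(a, b)` of the `r`-th matrix in the flattened parameter vector.
[folklore] -/
def matIdx (c k : ℕ) : Fin c × Fin k × Fin k ≃ Fin (c * k * k) :=
  ((Equiv.prodAssoc (Fin c) (Fin k) (Fin k)).symm.trans
    (finProdFinEquiv.prodCongr (Equiv.refl (Fin k)))).trans finProdFinEquiv

/-- The matrices encoded by a parameter vector. [folklore] -/
def decode (θ : Fin (c * k * k) → ℝ) : Fin c → Matrix (Fin k) (Fin k) ℝ :=
  fun r => Matrix.of fun a b => θ (matIdx c k (r, a, b))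

/-- The parameter vector of a tuple of matrices (all `c·k²` entries). [folklore] -/
def encode (G : Fin c → Matrix (Fin k) (Fin k) ℝ) : Fin (c * k * k) → ℝ :=
  fun s => G ((matIdx c k).symm s).1 ((matIdx c k).symm s).2.1 ((matIdx c k).symm s).2.2

/-- Decoding the parameter vector of a tuple of matrices returns the tuple. [folklore] -/
@[simp] private theorem decode_encode (G : Fin c → Matrix (Fin k) (Fin k) ℝ) : decode (encode G) = G := by
  funext r
  ext a b
  simp [decode, encode]

/-- The matrix pencil `Σ_r z_r G_r`. [folklore] -/
def pencil (G : Fin c → Matrix (Fin k) (Fin k) ℝ) (z : Fin c → ℝ) : Matrix (Fin k) (Fin k) ℝ :=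
  ∑ r, z r • G r

/-- Entries of the pencil. [folklore] -/
private theorem pencil_apply (G : Fin c → Matrix (Fin k) (Fin k) ℝ) (z : Fin c → ℝ) (a b : Fin k) :
    pencil G z a b = ∑ r, z r * G r a b := by
  simp [pencil, Matrix.sum_apply, Matrix.smul_apply]

/-- The universal pencil set `{(θ, z) ∈ ℝ^{ck²} × ℝ^c | Σ_r z_r G_r(θ) ⪰ 0}`. [folklore] -/
def pencilSet (c k : ℕ) : Set (Fin (c * k * k + c) → ℝ) :=
  {w | (pencil (decode fun s => w (Fin.castAdd c s)) fun r => w (Fin.natAdd (c * k * k) r)).PosSemidef}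

/-- The symbolic pencil `Σ_r Z_r Θ_r` with rational (indeed integer) coefficients. [folklore] -/
def symbPencil (c k : ℕ) : Matrix (Fin k) (Fin k) (MvPolynomial (Fin (c * k * k + c)) ℚ) :=
  Matrix.of fun a b => ∑ r : Fin c,
    MvPolynomial.X (Fin.natAdd (c * k * k) r) * MvPolynomial.X (Fin.castAdd c (matIdx c k (r, a, b)))

/-- The symbolic pencil evaluates to the pencil of the decoded matrices. [folklore] -/
private theorem symbPencil_map_aeval (w : Fin (c * k * k + c) → ℝ) :
    (symbPencil c k).map (MvPolynomial.aeval w) =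
      pencil (decode fun s => w (Fin.castAdd c s)) fun r => w (Fin.natAdd (c * k * k) r) := by
  ext a b
  simp [symbPencil, pencil_apply, decode, map_sum, map_mul, MvPolynomial.aeval_X]

/-- The universal pencil set is `ℚ`-semialgebraic. [folklore] -/
private theorem isSemialgebraic_pencilSet : IsSemialgebraic ℚ (pencilSet c k) := by
  have h := isSemialgebraic_setOf_posSemidef (symbPencil c k)
  convert h using 1
  ext w
  simp only [pencilSet, mem_setOf_eq, symbPencil_map_aeval]

end Pencil

section LiftFamily

variable {n m k : ℕ}

/-- Number of real parameters of a normal-form lift: `(1 + n + m)·k²` matrix entries.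
[cite: GouveiaRobinsonThomas2015, Thm. 2.1 proof (p05)] -/
abbrev nParams (n m k : ℕ) : ℕ := (1 + n + m) * k * k

/-- The coefficient vector `(1, x, u)` of the pencil `G₀ + Σ x_l G_l + Σ u_j G'_j`. [folklore] -/
def coefVec (x : Fin n → ℝ) (u : Fin m → ℝ) : Fin (1 + n + m) → ℝ :=
  Fin.append (Fin.append (fun _ : Fin 1 => (1 : ℝ)) x) u

/-- Membership in the lifted set `{x | ∃ u, G₀ + Σ x_l G_l + Σ u_j G'_j ⪰ 0}`.
[cite: GouveiaRobinsonThomas2015, Thm. 2.1 proof (p05)] -/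
def LiftMem (G : Fin (1 + n + m) → Matrix (Fin k) (Fin k) ℝ) (x : Fin n → ℝ) : Prop :=
  ∃ u : Fin m → ℝ, (pencil G (coefVec x u)).PosSemidef

/-- The polynomial (coordinate / constant) map `(θ, x, u) ↦ (θ, (1, x, u))`. [folklore] -/
def liftVars (n m k : ℕ) :
    Fin (nParams n m k + (1 + n + m)) → MvPolynomial (Fin (nParams n m k + n + m)) ℚ :=
  Fin.append (fun s => MvPolynomial.X (Fin.castAdd m (Fin.castAdd n s)))
    (Fin.append (Fin.append (fun _ : Fin 1 => 1)
      (fun l => MvPolynomial.X (Fin.castAdd m (Fin.natAdd (nParams n m k) l))))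
      (fun j => MvPolynomial.X (Fin.natAdd (nParams n m k + n) j)))

/-- Evaluation of the coordinate map at `(θ, x, u)` gives `(θ, (1, x, u))`. [folklore] -/
private theorem aeval_liftVars (θ : Fin (nParams n m k) → ℝ) (x : Fin n → ℝ) (u : Fin m → ℝ) :
    (fun j => MvPolynomial.aeval (Fin.append (Fin.append θ x) u) (liftVars n m k j)) =
      Fin.append θ (coefVec x u) := by
  funext j
  refine Fin.addCases (fun s => ?_) (fun r => ?_) j
  · simp [liftVars]
  · refine Fin.addCases (fun r' => ?_) (fun j' => ?_) r
    · refine Fin.addCases (fun o => ?_) (fun l => ?_) r'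
      · simp [liftVars, coefVec]
      · simp [liftVars, coefVec]
    · simp [liftVars, coefVec]

/-- The graph set `{(θ, x, u) | G₀(θ) + Σ x_l G_l(θ) + Σ u_j G'_j(θ) ⪰ 0}`. [folklore] -/
def liftGraph (n m k : ℕ) : Set (Fin (nParams n m k + n + m) → ℝ) :=
  (fun w => fun j => MvPolynomial.aeval w (liftVars n m k j)) ⁻¹' pencilSet (1 + n + m) k

/-- The graph set is `ℚ`-semialgebraic (a polynomial preimage of the pencil set). [folklore] -/
private theorem isSemialgebraic_liftGraph : IsSemialgebraic ℚ (liftGraph n m k) :=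
  isSemialgebraic_pencilSet.preimage_aeval _

/-- Membership of `(θ, x, u)` in the graph set. [folklore] -/
private theorem append_mem_liftGraph_iff (θ : Fin (nParams n m k) → ℝ) (x : Fin n → ℝ) (u : Fin m → ℝ) :
    Fin.append (Fin.append θ x) u ∈ liftGraph n m k ↔
      (pencil (decode θ) (coefVec x u)).PosSemidef := by
  simp only [liftGraph, mem_preimage, aeval_liftVars, pencilSet, mem_setOf_eq, Fin.append_left,
    Fin.append_right]

/-- Membership in a coordinate projection (forgetting the last block of coordinates). [folklore] -/
private theorem mem_image_castAdd_iff {p q : ℕ} (S : Set (Fin (p + q) → ℝ)) (v : Fin p → ℝ) :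
    v ∈ (fun w : Fin (p + q) → ℝ => fun i : Fin p => w (Fin.castAdd q i)) '' S ↔
      ∃ u : Fin q → ℝ, Fin.append v u ∈ S := by
  constructor
  · rintro ⟨w, hw, rfl⟩
    refine ⟨fun j => w (Fin.natAdd p j), ?_⟩
    rwa [Fin.append_castAdd_natAdd]
  · rintro ⟨u, hu⟩
    exact ⟨Fin.append v u, hu, funext fun i => Fin.append_left v u i⟩

/-- **The universal family** `𝒰 = {(θ, x) | ∃ u, G₀(θ) + Σ x_l G_l(θ) + Σ u_j G'_j(θ) ⪰ 0}` of all
normal-form psd lifts of size `k` with `n + m` free coordinates. [folklore] -/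
def liftFamily (n m k : ℕ) : Set (Fin (nParams n m k + n) → ℝ) :=
  (fun w : Fin (nParams n m k + n + m) → ℝ => fun i : Fin (nParams n m k + n) => w (Fin.castAdd m i)) ''
    liftGraph n m k

/-- The universal family is `ℚ`-semialgebraic (Tarski–Seidenberg over `ℚ`).
[cite: BochnakCosteRoy1998, Thm. 2.2.1] -/
theorem isSemialgebraic_liftFamily : IsSemialgebraic ℚ (liftFamily n m k) :=
  isSemialgebraic_liftGraph.image_castAdd

/-- Membership of `(θ, x)` in the universal family. [folklore] -/
private theorem append_mem_liftFamily_iff (θ : Fin (nParams n m k) → ℝ) (x : Fin n → ℝ) :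
    Fin.append θ x ∈ liftFamily n m k ↔ LiftMem (decode θ) x := by
  rw [liftFamily, mem_image_castAdd_iff]
  simp only [append_mem_liftGraph_iff, LiftMem]

/-! #### The optimum set of a rational linear functional -/

/-- `⟨ω, x⟩` for a rational `ω`. [folklore] -/
def dotRat (ω : Fin n → ℚ) (x : Fin n → ℝ) : ℝ := ∑ l, (ω l : ℝ) * x l

/-- The index map `(θ, x, y) ↦ (θ, y)`. [folklore] -/
def dropMiddle (n m k : ℕ) : Fin (nParams n m k + n) → Fin (nParams n m k + n + n) :=
  Fin.append (fun s : Fin (nParams n m k) => Fin.castAdd n (Fin.castAdd n s))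
    (fun l : Fin n => Fin.natAdd (nParams n m k + n) l)

/-- `(θ, x, y) ↦ (θ, y)` on points. [folklore] -/
private theorem append_comp_dropMiddle (θ : Fin (nParams n m k) → ℝ) (x y : Fin n → ℝ) :
    (Fin.append (Fin.append θ x) y) ∘ dropMiddle n m k = Fin.append θ y := by
  funext j
  refine Fin.addCases (fun s => ?_) (fun l => ?_) j
  · simp [dropMiddle]
  · simp [dropMiddle]

/-- `{(θ, x, y) | (θ, y) ∈ 𝒰, ⟨ω, x⟩ < ⟨ω, y⟩}`. [folklore] -/
def betterSet (n m k : ℕ) (ω : Fin n → ℚ) : Set (Fin (nParams n m k + n + n) → ℝ) :=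
  ((fun w : Fin (nParams n m k + n + n) → ℝ => w ∘ dropMiddle n m k) ⁻¹' liftFamily n m k) ∩
    {w | 0 < MvPolynomial.aeval w (∑ l : Fin n, MvPolynomial.C (ω l) *
      (MvPolynomial.X (Fin.natAdd (nParams n m k + n) l) -
        MvPolynomial.X (Fin.castAdd n (Fin.natAdd (nParams n m k) l))))}

/-- `betterSet` is `ℚ`-semialgebraic. [folklore] -/
private theorem isSemialgebraic_betterSet (ω : Fin n → ℚ) : IsSemialgebraic ℚ (betterSet n m k ω) :=
  (isSemialgebraic_liftFamily.preimage_comp _).inter (isSemialgebraic_setOf_eval_pos _)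

/-- Membership of `(θ, x, y)` in `betterSet`. [folklore] -/
private theorem append_mem_betterSet_iff (ω : Fin n → ℚ) (θ : Fin (nParams n m k) → ℝ) (x y : Fin n → ℝ) :
    Fin.append (Fin.append θ x) y ∈ betterSet n m k ω ↔
      LiftMem (decode θ) y ∧ dotRat ω x < dotRat ω y := by
  simp only [betterSet, mem_inter_iff, mem_preimage, append_comp_dropMiddle,
    append_mem_liftFamily_iff, mem_setOf_eq, map_sum, map_mul, map_sub, MvPolynomial.aeval_C,
    MvPolynomial.aeval_X, Fin.append_right, Fin.append_left, dotRat]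
  simp only [eq_ratCast, mul_sub, Finset.sum_sub_distrib, sub_pos]

/-- **The optimum set** `{(θ, x) ∈ 𝒰 | ⟨ω, y⟩ ≤ ⟨ω, x⟩ for all (θ, y) ∈ 𝒰}` — `ℚ`-semialgebraic by
one more quantifier elimination. [cite: BochnakCosteRoy1998, Thm. 2.2.1] -/
def optSet (n m k : ℕ) (ω : Fin n → ℚ) : Set (Fin (nParams n m k + n) → ℝ) :=
  liftFamily n m k \
    (fun w : Fin (nParams n m k + n + n) → ℝ => fun i : Fin (nParams n m k + n) => w (Fin.castAdd n i)) ''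
      betterSet n m k ω

/-- The optimum set is `ℚ`-semialgebraic (Tarski–Seidenberg over `ℚ`). [cite: BochnakCosteRoy1998, Thm. 2.2.1] -/
theorem isSemialgebraic_optSet (ω : Fin n → ℚ) : IsSemialgebraic ℚ (optSet n m k ω) :=
  isSemialgebraic_liftFamily.diff (isSemialgebraic_betterSet ω).image_castAdd

/-- Membership of `(θ, x)` in the optimum set. [folklore] -/
private theorem append_mem_optSet_iff (ω : Fin n → ℚ) (θ : Fin (nParams n m k) → ℝ) (x : Fin n → ℝ) :
    Fin.append θ x ∈ optSet n m k ω ↔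
      LiftMem (decode θ) x ∧ ∀ y, LiftMem (decode θ) y → dotRat ω y ≤ dotRat ω x := by
  rw [optSet, Set.mem_sdiff, append_mem_liftFamily_iff, mem_image_castAdd_iff]
  simp only [append_mem_betterSet_iff, not_exists, not_and, not_lt]

/-- The index map `(θ, x) ↦ (x_i, θ)`. [folklore] -/
def coordIdx (n m k : ℕ) (i : Fin n) : Fin (nParams n m k + 1) → Fin (nParams n m k + n) :=
  Fin.cons (Fin.natAdd (nParams n m k) i) fun s => Fin.castAdd n s

/-- `{(x_i, θ) | (θ, x) optimal}`. [folklore] -/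
def coordSet (n m k : ℕ) (ω : Fin n → ℚ) (i : Fin n) : Set (Fin (nParams n m k + 1) → ℝ) :=
  (fun w : Fin (nParams n m k + n) → ℝ => w ∘ coordIdx n m k i) '' optSet n m k ω

/-- The coordinate image of the optimum set is `ℚ`-semialgebraic (Tarski–Seidenberg over `ℚ`).
[cite: BochnakCosteRoy1998, Thm. 2.2.1] -/
theorem isSemialgebraic_coordSet (ω : Fin n → ℚ) (i : Fin n) :
    IsSemialgebraic ℚ (coordSet n m k ω i) :=
  (isSemialgebraic_optSet ω).image_comp _

/-- Membership of `(t, θ)` in the coordinate set. [folklore] -/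
private theorem cons_mem_coordSet_iff (ω : Fin n → ℚ) (i : Fin n) (θ : Fin (nParams n m k) → ℝ) (t : ℝ) :
    (Fin.cons t θ : Fin (nParams n m k + 1) → ℝ) ∈ coordSet n m k ω i ↔
      ∃ x : Fin n → ℝ, Fin.append θ x ∈ optSet n m k ω ∧ x i = t := by
  constructor
  · rintro ⟨w, hw, hwt⟩
    refine ⟨fun l => w (Fin.natAdd (nParams n m k) l), ?_, ?_⟩
    · have hθ : (fun s => w (Fin.castAdd n s)) = θ := by
        funext s
        have := congrFun hwt (Fin.succ s)
        simpa [coordIdx] using this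
      rw [← hθ, Fin.append_castAdd_natAdd]
      exact hw
    · have := congrFun hwt 0
      simpa [coordIdx] using this
  · rintro ⟨x, hx, rfl⟩
    refine ⟨Fin.append θ x, hx, ?_⟩
    funext j
    refine Fin.cases ?_ (fun s => ?_) j
    · simp [coordIdx]
    · simp [coordIdx]

end LiftFamily

section LiftMemDefs
variable {n m k : ℕ}

/-- The pencil of the block tuple `(G₀, P, Q)` at `(1, x, u)` is `G₀ + Σ x_l P_l + Σ u_j Q_j`.
[folklore] -/
private theorem pencil_append_coefVec (G₀ : Matrix (Fin k) (Fin k) ℝ) (P : Fin n → Matrix (Fin k) (Fin k) ℝ)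
    (Q : Fin m → Matrix (Fin k) (Fin k) ℝ) (x : Fin n → ℝ) (u : Fin m → ℝ) :
    pencil (Fin.append (Fin.append (fun _ : Fin 1 => G₀) P) Q) (coefVec x u) =
      G₀ + ∑ l, x l • P l + ∑ j, u j • Q j := by
  simp only [pencil, coefVec, Fin.sum_univ_add, Fin.append_left, Fin.append_right,
    Fin.sum_univ_one, one_smul]

end LiftMemDefs

/-! ### §3 Normal form of a full-dimensional bounded psd lift -/

section NormalForm

variable {n k : ℕ}

/-- In `ℝⁿ`, `n ≥ 1`, a set with an interior point is not contained in a singleton. [folklore] -/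
private theorem not_subset_singleton_of_interior_nonempty (hn : 1 ≤ n) {C : Set (Fin n → ℝ)}
    (hint : (interior C).Nonempty) (a : Fin n → ℝ) : ¬ C ⊆ {a} := by
  intro h
  haveI : Nonempty (Fin n) := ⟨⟨0, hn⟩⟩
  haveI : NeBot (𝓝[≠] a) := Module.punctured_nhds_neBot ℝ (Fin n → ℝ) a
  have h1 : (interior ({a} : Set (Fin n → ℝ))).Nonempty := hint.mono (interior_mono h)
  rw [interior_singleton] at h1
  exact Set.not_nonempty_empty h1

/-- If `{a₀ + Λ w : w ∈ S}` has nonempty interior then the linear map `Λ` is onto. [folklore] -/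
private theorem surjective_of_interior_image_nonempty {N : ℕ} (a₀ : Fin n → ℝ)
    (Λ : (Fin N → ℝ) →ₗ[ℝ] (Fin n → ℝ)) (S : Set (Fin N → ℝ))
    (hint : (interior ((fun w => a₀ + Λ w) '' S)).Nonempty) : Function.Surjective Λ := by
  have hsub : (fun w => a₀ + Λ w) '' S ⊆
      (Homeomorph.addLeft a₀) '' (LinearMap.range Λ : Set (Fin n → ℝ)) := by
    rintro _ ⟨w, -, rfl⟩
    exact ⟨Λ w, LinearMap.mem_range_self Λ w, rfl⟩
  have h1 : (interior ((Homeomorph.addLeft a₀) ''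
      (LinearMap.range Λ : Set (Fin n → ℝ)))).Nonempty := hint.mono (interior_mono hsub)
  rw [← Homeomorph.image_interior, Set.image_nonempty] at h1
  exact LinearMap.range_eq_top.1 ((LinearMap.range Λ).eq_top_of_nonempty_interior' h1)

/-- A bounded set contains no ray `{a + t v : t ≥ 0}` with `v ≠ 0`. [folklore] -/
private theorem eq_zero_of_ray_subset {C : Set (Fin n → ℝ)} (hbd : Bornology.IsBounded C)
    (a v : Fin n → ℝ) (h : ∀ t : ℝ, 0 ≤ t → a + t • v ∈ C) : v = 0 := by
  by_contra hv
  obtain ⟨R, hR⟩ := hbd.exists_norm_le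
  have hvpos : 0 < ‖v‖ := norm_pos_iff.2 hv
  have hR0 : 0 ≤ R := (norm_nonneg _).trans (hR _ (h 0 le_rfl))
  set t : ℝ := (R + ‖a‖ + 1) / ‖v‖ with ht
  have ht0 : 0 ≤ t := div_nonneg (by positivity) hvpos.le
  have h1 := hR _ (h t ht0)
  have h2 : ‖t • v‖ = R + ‖a‖ + 1 := by
    rw [norm_smul, Real.norm_of_nonneg ht0, ht, div_mul_cancel₀ _ hvpos.ne']
  have h3 : ‖t • v‖ ≤ ‖a + t • v‖ + ‖a‖ := by
    have := norm_sub_le (a + t • v) a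
    rwa [add_sub_cancel_left] at this
  linarith

/-- **Normal form of a bounded full-dimensional psd lift.** If `C ⊆ ℝⁿ` (`n ≥ 1`) is bounded with
nonempty interior and has a psd lift of size `k`, then
`C = {x | ∃ u ∈ ℝ^m, G₀ + Σ_l x_l G_l + Σ_j u_j G'_j ⪰ 0}` for some `k × k` matrices with
`1 + n + m ≤ k²` ("we may assume that this linear map is the projection onto the first `n`
coordinates": affine coordinates on `L` adapted to `π`; the count because the symmetric part of
the direction of `L` is a proper subspace of the `k × k` matrices when `k ≥ 2`, while `k ≤ 1` would
make `C` a point or unbounded). [cite: GouveiaRobinsonThomas2015, Thm. 2.1 proof (p05)] -/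
theorem exists_normalForm {C : Set (Fin n → ℝ)} (h : HasPsdLift C k)
    (hint : (interior C).Nonempty) (hbd : Bornology.IsBounded C) (hn : 1 ≤ n) :
    ∃ (m : ℕ) (G : Fin (1 + n + m) → Matrix (Fin k) (Fin k) ℝ),
      1 + n + m ≤ k ^ 2 ∧ ∀ x, x ∈ C ↔ LiftMem G x := by
  classical
  obtain ⟨L, π, rfl⟩ := h
  obtain ⟨-, M₁, ⟨hM₁, hM₁L⟩, -⟩ := hint.mono interior_subset
  -- the symmetric part of the direction of `L`, with a basis
  let D : Submodule ℝ (Matrix (Fin k) (Fin k) ℝ) :=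
    { carrier := {v | v ∈ L.direction ∧ vᵀ = v}
      add_mem' := fun {a b} ha hb =>
        ⟨L.direction.add_mem ha.1 hb.1, by rw [Matrix.transpose_add, ha.2, hb.2]⟩
      zero_mem' := ⟨L.direction.zero_mem, Matrix.transpose_zero⟩
      smul_mem' := fun c {v} hv =>
        ⟨L.direction.smul_mem c hv.1, by rw [Matrix.transpose_smul, hv.2]⟩ }
  have hDmem : ∀ v, v ∈ D ↔ v ∈ L.direction ∧ vᵀ = v := fun v => Iff.rfl
  set N : ℕ := Module.finrank ℝ D with hNdef
  let b : Module.Basis (Fin N) ℝ D := Module.finBasis ℝ D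
  let β : (Fin N → ℝ) →ₗ[ℝ] Matrix (Fin k) (Fin k) ℝ :=
    Fintype.linearCombination ℝ (fun t => (b t : Matrix (Fin k) (Fin k) ℝ))
  have hβ : ∀ w, β w = ∑ t, w t • (b t : Matrix (Fin k) (Fin k) ℝ) := fun w =>
    Fintype.linearCombination_apply _ _ w
  have hβD : ∀ w, β w ∈ D := fun w => by
    rw [hβ]
    exact D.sum_mem fun t _ => D.smul_mem _ (b t).2
  have hβsurj : ∀ v ∈ D, ∃ w, β w = v := by
    intro v hv
    refine ⟨b.repr ⟨v, hv⟩, ?_⟩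
    have h1 := congrArg Subtype.val (b.sum_repr ⟨v, hv⟩)
    rw [Submodule.coe_sum] at h1
    rw [hβ]
    simpa only [Submodule.coe_smul] using h1
  have hM₁s : M₁ᵀ = M₁ := (Matrix.isHermitian_iff_isSymm.1 hM₁.1).eq
  -- `S^k_+ ∩ L = {M₁ + β w ⪰ 0}`
  have hSL : ∀ M, (M.PosSemidef ∧ M ∈ L) ↔ ∃ w, (M₁ + β w).PosSemidef ∧ M = M₁ + β w := by
    intro M
    constructor
    · rintro ⟨hM, hML⟩
      have hv : M - M₁ ∈ D := (hDmem _).2 ⟨AffineSubspace.vsub_mem_direction hML hM₁L, by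
        rw [Matrix.transpose_sub, (Matrix.isHermitian_iff_isSymm.1 hM.1).eq, hM₁s]⟩
      obtain ⟨w, hw⟩ := hβsurj _ hv
      refine ⟨w, ?_, ?_⟩
      · rw [hw, add_sub_cancel]
        exact hM
      · rw [hw, add_sub_cancel]
    · rintro ⟨w, hw, rfl⟩
      refine ⟨hw, ?_⟩
      have hdir : β w ∈ L.direction := ((hDmem _).1 (hβD w)).1
      have h1 := AffineSubspace.vadd_mem_of_mem_direction hdir hM₁L
      rwa [vadd_eq_add, add_comm] at h1
  -- `C = a₀ + Λ W`
  set a₀ : Fin n → ℝ := π M₁ with ha₀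
  let Λ : (Fin N → ℝ) →ₗ[ℝ] (Fin n → ℝ) := π ∘ₗ β
  have hΛw : ∀ w, Λ w = π (β w) := fun w => rfl
  have hC : π '' {M | M.PosSemidef ∧ M ∈ L} =
      (fun w => a₀ + Λ w) '' {w | (M₁ + β w).PosSemidef} := by
    ext y
    simp only [mem_image, mem_setOf_eq]
    constructor
    · rintro ⟨M, hM, rfl⟩
      obtain ⟨w, hw, rfl⟩ := (hSL M).1 hM
      exact ⟨w, hw, by rw [map_add, hΛw]⟩
    · rintro ⟨w, hw, rfl⟩
      exact ⟨M₁ + β w, (hSL _).2 ⟨w, hw, rfl⟩, by rw [map_add, hΛw]⟩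
  have hΛ : Function.Surjective Λ :=
    surjective_of_interior_image_nonempty a₀ Λ _ (hC ▸ hint)
  -- the count `1 + N ≤ k²`
  have hcount : 1 + N ≤ k ^ 2 := by
    rcases Nat.lt_or_ge k 2 with hk | hk
    · obtain hk0 | hk1 : k = 0 ∨ k = 1 := by omega
      · -- `k = 0`: all `0 × 0` matrices coincide, so `C ⊆ {a₀}`
        exfalso
        haveI : IsEmpty (Fin k) := by rw [hk0]; infer_instance
        refine not_subset_singleton_of_interior_nonempty hn hint a₀ ?_
        rintro y ⟨M, -, rfl⟩
        have hM : M = M₁ := Subsingleton.elim _ _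
        rw [hM, mem_singleton_iff]
      · -- `k = 1`: `N ≤ 1`, and `N = 1` would put a ray inside `C` or collapse `C` to a point
        have hkk : k * k = 1 := by rw [hk1]
        have hN1 : N ≤ 1 := by
          have h1 := Submodule.finrank_le D
          rw [Module.finrank_matrix, Fintype.card_fin, Module.finrank_self, hkk] at h1
          simpa using h1
        by_contra hcon
        have hk2 : k ^ 2 = 1 := by rw [sq, hkk]
        rw [hk2] at hcon
        have hN : N = 1 := by omega
        have hD : D = ⊤ := Submodule.eq_top_of_finrank_eq (by
          rw [Module.finrank_matrix, Fintype.card_fin, Module.finrank_self, ← hNdef, hN, hkk])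
        obtain ⟨w₀, hw₀⟩ := hβsurj 1 (hD ▸ Submodule.mem_top)
        -- the ray `a₀ + t Λ w₀`, `t ≥ 0`, lies in `C`
        have hray : ∀ t : ℝ, 0 ≤ t → a₀ + t • Λ w₀ ∈ π '' {M | M.PosSemidef ∧ M ∈ L} := by
          intro t ht
          rw [hC]
          refine ⟨t • w₀, ?_, by dsimp only; rw [map_smul]⟩
          show (M₁ + β (t • w₀)).PosSemidef
          rw [map_smul, hw₀]
          exact hM₁.add (Matrix.PosSemidef.one.smul ht)
        have hΛ0 : Λ w₀ = 0 := eq_zero_of_ray_subset hbd a₀ (Λ w₀) hray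
        -- every `w` is a multiple of `w₀`, so `Λ = 0`, contradicting surjectivity
        let i₀ : Fin N := ⟨0, by omega⟩
        have hi : ∀ i : Fin N, i = i₀ := fun i => Fin.ext (by have := i.2; simp only [i₀]; omega)
        have hw₀ne : w₀ i₀ ≠ 0 := by
          intro h0
          have hz : w₀ = 0 := funext fun i => by rw [hi i, h0]; rfl
          rw [hz, map_zero] at hw₀
          have h00 := congrFun (congrFun hw₀ (⟨0, by omega⟩ : Fin k)) ⟨0, by omega⟩
          simp at h00
        obtain ⟨w, hw⟩ := hΛ fun _ => 1
        have hwm : w = (w i₀ / w₀ i₀) • w₀ := funext fun i => by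
          rw [hi i, Pi.smul_apply, smul_eq_mul, div_mul_cancel₀ _ hw₀ne]
        rw [hwm, map_smul, hΛ0, smul_zero] at hw
        have := congrFun hw ⟨0, hn⟩
        simp at this
    · -- `k ≥ 2`: `D` misses the non-symmetric matrix unit `E_{01}`
      let i₀ : Fin k := ⟨0, by omega⟩
      let i₁ : Fin k := ⟨1, by omega⟩
      have h01 : i₀ ≠ i₁ := by
        simp only [Ne, Fin.ext_iff, i₀, i₁]
        exact Nat.zero_ne_one
      have hE : Matrix.single i₀ i₁ (1 : ℝ) ∉ D := by
        intro hE
        have h1 := congrFun (congrFun ((hDmem _).1 hE).2 i₁) i₀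
        rw [Matrix.transpose_apply, Matrix.single_apply_same,
          Matrix.single_apply_of_row_ne h01] at h1
        exact one_ne_zero h1
      have hlt : N < Module.finrank ℝ (Matrix (Fin k) (Fin k) ℝ) :=
        Submodule.finrank_lt fun hD => hE (hD ▸ Submodule.mem_top)
      rw [Module.finrank_matrix, Fintype.card_fin, Module.finrank_self, mul_one] at hlt
      rw [sq]
      omega
  -- coordinates adapted to `Λ`
  obtain ⟨R, hR⟩ := Λ.exists_rightInverse_of_surjective (LinearMap.range_eq_top.2 hΛ)
  have hRx : ∀ x, Λ (R x) = x := fun x => by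
    have := LinearMap.congr_fun hR x
    simpa using this
  let K : Submodule ℝ (Fin N → ℝ) := LinearMap.ker Λ
  set m : ℕ := Module.finrank ℝ K with hmdef
  let bK : Module.Basis (Fin m) ℝ K := Module.finBasis ℝ K
  let κ : (Fin m → ℝ) →ₗ[ℝ] (Fin N → ℝ) :=
    Fintype.linearCombination ℝ (fun j => (bK j : Fin N → ℝ))
  have hκ : ∀ u, κ u = ∑ j, u j • (bK j : Fin N → ℝ) := fun u =>
    Fintype.linearCombination_apply _ _ u
  have hκ0 : ∀ u, Λ (κ u) = 0 := fun u => by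
    rw [hκ, map_sum]
    exact Finset.sum_eq_zero fun j _ => by rw [map_smul, LinearMap.mem_ker.1 (bK j).2, smul_zero]
  have hdecomp : ∀ w, ∃ u, R (Λ w) + κ u = w := by
    intro w
    have hv : w - R (Λ w) ∈ K := by
      rw [LinearMap.mem_ker, map_sub, hRx, sub_self]
    refine ⟨bK.repr ⟨w - R (Λ w), hv⟩, ?_⟩
    have hsum : ∑ j, (bK.repr ⟨w - R (Λ w), hv⟩) j • (bK j : Fin N → ℝ) = w - R (Λ w) := by
      have h1 := congrArg Subtype.val (bK.sum_repr ⟨w - R (Λ w), hv⟩)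
      rw [Submodule.coe_sum] at h1
      simpa only [Submodule.coe_smul] using h1
    rw [hκ, hsum, add_sub_cancel]
  have hnm : n + m = N := by
    have h1 := LinearMap.finrank_range_add_finrank_ker Λ
    rw [LinearMap.range_eq_top.2 hΛ, finrank_top, Module.finrank_fin_fun,
      Module.finrank_fin_fun] at h1
    exact h1
  -- the matrices
  let G₀ : Matrix (Fin k) (Fin k) ℝ := M₁ - β (R a₀)
  let P : Fin n → Matrix (Fin k) (Fin k) ℝ := fun l => β (R fun j => if l = j then 1 else 0)
  let Q : Fin m → Matrix (Fin k) (Fin k) ℝ := fun j => β (κ fun j' => if j = j' then 1 else 0)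
  have hpen : ∀ (x : Fin n → ℝ) (u : Fin m → ℝ),
      pencil (Fin.append (Fin.append (fun _ : Fin 1 => G₀) P) Q) (coefVec x u) =
        M₁ + β (R (x - a₀) + κ u) := by
    intro x u
    rw [pencil_append_coefVec]
    have h1 : ∑ l, x l • P l = β (R x) := by
      have := LinearMap.pi_apply_eq_sum_univ (β ∘ₗ R) x
      rw [LinearMap.comp_apply] at this
      rw [this]
      rfl
    have h2 : ∑ j, u j • Q j = β (κ u) := by
      have := LinearMap.pi_apply_eq_sum_univ (β ∘ₗ κ) u
      rw [LinearMap.comp_apply] at this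
      rw [this]
      rfl
    rw [h1, h2]
    simp only [G₀, map_add, map_sub]
    abel
  refine ⟨m, Fin.append (Fin.append (fun _ : Fin 1 => G₀) P) Q, by rw [add_assoc, hnm]; exact hcount,
    fun x => ?_⟩
  rw [hC]
  constructor
  · rintro ⟨w, hw, rfl⟩
    obtain ⟨u, hu⟩ := hdecomp w
    refine ⟨u, ?_⟩
    rw [hpen, add_sub_cancel_left, hu]
    exact hw
  · rintro ⟨u, hu⟩
    refine ⟨R (x - a₀) + κ u, ?_, ?_⟩
    · show (M₁ + β (R (x - a₀) + κ u)).PosSemidef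
      rw [← hpen]
      exact hu
    · show a₀ + Λ (R (x - a₀) + κ u) = x
      rw [map_add, hRx, hκ0, add_zero, add_sub_cancel]

end NormalForm

/-! ### §4 Vertices are exposed by rational functionals -/

section Exposed

variable {n v : ℕ}

/-- `⟨ω, x + y⟩ = ⟨ω, x⟩ + ⟨ω, y⟩`. [folklore] -/
private theorem dotRat_add (ω : Fin n → ℚ) (x y : Fin n → ℝ) :
    dotRat ω (x + y) = dotRat ω x + dotRat ω y := by
  simp only [dotRat, Pi.add_apply, mul_add, Finset.sum_add_distrib]

/-- `⟨ω, a x⟩ = a ⟨ω, x⟩`. [folklore] -/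
private theorem dotRat_smul (ω : Fin n → ℚ) (a : ℝ) (x : Fin n → ℝ) :
    dotRat ω (a • x) = a * dotRat ω x := by
  simp only [dotRat, Pi.smul_apply, smul_eq_mul, Finset.mul_sum]
  exact Finset.sum_congr rfl fun l _ => by ring

/-- `⟨ω, x − y⟩ = ⟨ω, x⟩ − ⟨ω, y⟩`. [folklore] -/
private theorem dotRat_sub (ω : Fin n → ℚ) (x y : Fin n → ℝ) :
    dotRat ω (x - y) = dotRat ω x - dotRat ω y := by
  simp only [dotRat, Pi.sub_apply, mul_sub, Finset.sum_sub_distrib]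

/-- An extreme point of the convex hull of finitely many distinct points is not in the convex hull
of the other points. [folklore] -/
private theorem not_mem_convexHull_image_ne (x : Fin v → (Fin n → ℝ)) (hx : Function.Injective x)
    (i : Fin v) (hext : x i ∈ (convexHull ℝ (Set.range x)).extremePoints ℝ) :
    x i ∉ convexHull ℝ (x '' {j | j ≠ i}) := by
  have hconv := (convex_convexHull ℝ (Set.range x)).mem_extremePoints_iff_convex_sdiff.1 hext
  have hsub : x '' {j | j ≠ i} ⊆ convexHull ℝ (Set.range x) \ {x i} := by
    rintro _ ⟨j, hj, rfl⟩
    exact ⟨subset_convexHull ℝ _ ⟨j, rfl⟩, fun h => hj (hx h)⟩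
  intro hmem
  exact ((convexHull_min hsub hconv.2) hmem).2 rfl

/-- **Strict separation by a real functional**: an extreme point `x_i` of `conv{x_j}` (distinct
points) admits `c ∈ ℝⁿ` with `⟨c, x_j⟩ < ⟨c, x_i⟩` for all `j ≠ i` (Hahn–Banach against the compact
convex hull of the other points). [cite: GouveiaRobinsonThomas2015, Thm. 2.1 proof (p05)] -/
theorem exists_real_strict (x : Fin v → (Fin n → ℝ)) (hx : Function.Injective x)
    (i : Fin v) (hext : x i ∈ (convexHull ℝ (Set.range x)).extremePoints ℝ) :
    ∃ c : Fin n → ℝ, ∀ j, j ≠ i → ∑ l, c l * x j l < ∑ l, c l * x i l := by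
  have hScpt : IsCompact (convexHull ℝ (x '' {j | j ≠ i})) :=
    ((Set.toFinite {j : Fin v | j ≠ i}).image x).isCompact_convexHull ℝ
  obtain ⟨f, u, hfu, hux⟩ : ∃ (f : StrongDual ℝ (Fin n → ℝ)) (u : ℝ),
      (∀ a ∈ convexHull ℝ (x '' {j | j ≠ i}), f a < u) ∧ u < f (x i) :=
    geometric_hahn_banach_closed_point (convex_convexHull ℝ _) hScpt.isClosed
      (not_mem_convexHull_image_ne x hx i hext)
  refine ⟨fun l => f (fun j => if l = j then 1 else 0), fun j hj => ?_⟩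
  have hf : ∀ y : Fin n → ℝ, f y = ∑ l, (f fun j => if l = j then 1 else 0) * y l := by
    intro y
    have h1 := LinearMap.pi_apply_eq_sum_univ (f : (Fin n → ℝ) →ₗ[ℝ] ℝ) y
    simp only [ContinuousLinearMap.coe_coe, smul_eq_mul] at h1
    rw [h1]
    exact Finset.sum_congr rfl fun l _ => mul_comm _ _
  rw [← hf, ← hf]
  exact (hfu _ (subset_convexHull ℝ _ ⟨j, hj, rfl⟩)).trans hux

/-- **Vertices are exposed by rational functionals.** Perturbing the real functional of
`exists_real_strict` within the open set of functionals satisfying the finitely many strict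
inequalities, using the density of `ℚⁿ` in `ℝⁿ` ("`ω ∈ ℚⁿ` a vector such that the linear program
`max {ωᵀx : x ∈ P}` has `p` as its unique optimal point"). [cite: GouveiaRobinsonThomas2015, Thm. 2.1 proof (p05)] -/
theorem exists_rat_strict (x : Fin v → (Fin n → ℝ)) (hx : Function.Injective x)
    (i : Fin v) (hext : x i ∈ (convexHull ℝ (Set.range x)).extremePoints ℝ) :
    ∃ ω : Fin n → ℚ, ∀ j, j ≠ i → dotRat ω (x j) < dotRat ω (x i) := by
  classical
  obtain ⟨c, hc⟩ := exists_real_strict x hx i hext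
  -- the open set of good functionals
  set O : Set (Fin n → ℝ) :=
    ⋂ j ∈ (Finset.univ.filter fun j : Fin v => j ≠ i), {c' | 0 < ∑ l, c' l * (x i l - x j l)} with hO
  have hOopen : IsOpen O := by
    refine isOpen_biInter_finset fun j _ => ?_
    exact isOpen_lt continuous_const
      (continuous_finsetSum _ fun l _ => (continuous_apply l).mul continuous_const)
  have hcO : c ∈ O := by
    simp only [hO, mem_iInter, Finset.mem_filter, Finset.mem_univ, true_and, mem_setOf_eq]
    intro j hj
    have := hc j hj
    rw [← sub_pos, ← Finset.sum_sub_distrib] at this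
    simpa only [mul_sub] using this
  obtain ⟨ε, hε, hball⟩ := Metric.isOpen_iff.1 hOopen c hcO
  -- a rational point in the ball
  have hq : ∀ l, ∃ q : ℚ, c l - ε < q ∧ (q : ℝ) < c l + ε := fun l =>
    exists_rat_btwn (by linarith)
  choose q hq using hq
  refine ⟨q, fun j hj => ?_⟩
  have hmem : (fun l => (q l : ℝ)) ∈ O := by
    apply hball
    rw [Metric.mem_ball, dist_pi_lt_iff hε]
    intro l
    rw [Real.dist_eq, abs_sub_lt_iff]
    constructor <;> linarith [(hq l).1, (hq l).2]
  simp only [hO, mem_iInter, Finset.mem_filter, Finset.mem_univ, true_and, mem_setOf_eq] at hmem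
  have := hmem j hj
  rw [← sub_pos, dotRat, dotRat, ← Finset.sum_sub_distrib]
  simpa only [mul_sub] using this

/-- The convex hull lies in the half-space `⟨ω, ·⟩ ≤ ⟨ω, x_i⟩` (`p` is an optimal point of the linear
program). [cite: GouveiaRobinsonThomas2015, Thm. 2.1 proof (p05)] -/
theorem dotRat_le_of_mem_convexHull (x : Fin v → (Fin n → ℝ)) (i : Fin v) (ω : Fin n → ℚ)
    (hω : ∀ j, j ≠ i → dotRat ω (x j) < dotRat ω (x i)) {y : Fin n → ℝ}
    (hy : y ∈ convexHull ℝ (Set.range x)) : dotRat ω y ≤ dotRat ω (x i) := by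
  have hconv : Convex ℝ {z : Fin n → ℝ | dotRat ω z ≤ dotRat ω (x i)} := by
    refine convex_iff_pairwise_pos.2 fun p hp p' hp' _ a b ha hb hab => ?_
    simp only [mem_setOf_eq] at hp hp' ⊢
    rw [dotRat_add, dotRat_smul, dotRat_smul]
    have h1 := mul_le_mul_of_nonneg_left hp ha.le
    have h2 := mul_le_mul_of_nonneg_left hp' hb.le
    have h3 : a * dotRat ω (x i) + b * dotRat ω (x i) = dotRat ω (x i) := by
      rw [← add_mul, hab, one_mul]
    linarith
  refine convexHull_min ?_ hconv hy
  rintro _ ⟨j, rfl⟩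
  by_cases hj : j = i
  · rw [hj]
    show dotRat ω (x i) ≤ dotRat ω (x i)
    exact le_rfl
  · exact (hω j hj).le

/-- **Uniqueness of the optimum**: the only maximiser of `⟨ω, ·⟩` on `conv{x_j}` is `x_i` (the set
`{⟨ω, ·⟩ < ⟨ω, x_i⟩} ∪ {x_i}` is convex and contains every `x_j`; "has `p` as its unique optimal point").
[cite: GouveiaRobinsonThomas2015, Thm. 2.1 proof (p05)] -/
theorem eq_of_isMax_dotRat (x : Fin v → (Fin n → ℝ)) (i : Fin v) (ω : Fin n → ℚ)
    (hω : ∀ j, j ≠ i → dotRat ω (x j) < dotRat ω (x i)) {y : Fin n → ℝ}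
    (hy : y ∈ convexHull ℝ (Set.range x)) (hmax : dotRat ω (x i) ≤ dotRat ω y) : y = x i := by
  set H : Set (Fin n → ℝ) := {z | dotRat ω z < dotRat ω (x i)} ∪ {x i} with hH
  have hconv : Convex ℝ H := by
    refine convex_iff_pairwise_pos.2 fun p hp p' hp' hne a b ha hb hab => ?_
    left
    simp only [mem_setOf_eq]
    rw [dotRat_add, dotRat_smul, dotRat_smul]
    have h3 : a * dotRat ω (x i) + b * dotRat ω (x i) = dotRat ω (x i) := by
      rw [← add_mul, hab, one_mul]
    rcases hp with hp | hp <;> rcases hp' with hp' | hp'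
    · simp only [mem_setOf_eq] at hp hp'
      have h1 := mul_lt_mul_of_pos_left hp ha
      have h2 := mul_lt_mul_of_pos_left hp' hb
      linarith
    · simp only [mem_setOf_eq] at hp
      rw [mem_singleton_iff] at hp'
      rw [hp']
      have h1 := mul_lt_mul_of_pos_left hp ha
      linarith
    · simp only [mem_setOf_eq] at hp'
      rw [mem_singleton_iff] at hp
      rw [hp]
      have h2 := mul_lt_mul_of_pos_left hp' hb
      linarith
    · rw [mem_singleton_iff] at hp hp'
      exact absurd (hp.trans hp'.symm) hne
  have hsub : Set.range x ⊆ H := by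
    rintro _ ⟨j, rfl⟩
    by_cases hj : j = i
    · right
      rw [hj]
      rfl
    · left
      exact hω j hj
  rcases convexHull_min hsub hconv hy with h | h
  · simp only [mem_setOf_eq] at h
    exact absurd hmax (not_le.2 h)
  · exact h

end Exposed

/-! ### §5 The discharge -/

section Assembly

variable {n m k v : ℕ}

/-- **Step (b) of the printed proof**: the coordinates of the unique optimum `p` of a rational linear
functional over a normal-form lifted set `{x | ∃ u, G₀ + Σ x_l G_l + Σ u_j G'_j ⪰ 0}` are algebraic
over the field `ℚ(Γ)` generated by the entries of the matrices ("the coordinates `p_1, …, p_n` are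
contained in the real closure of `ℚ(Γ)`", here by Tarski–Seidenberg over `ℚ` with the entries as
variables and the genericity of transcendental fibres, instead of semidefinite duality).
[cite: GouveiaRobinsonThomas2015, Thm. 2.1 proof (p05)] -/
theorem isAlgebraic_of_unique_optimum (G : Fin (1 + n + m) → Matrix (Fin k) (Fin k) ℝ)
    (ω : Fin n → ℚ) {p : Fin n → ℝ} (hp : LiftMem G p)
    (hmax : ∀ y, LiftMem G y → dotRat ω y ≤ dotRat ω p)
    (huniq : ∀ x, LiftMem G x → (∀ y, LiftMem G y → dotRat ω y ≤ dotRat ω x) → x = p)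
    (i : Fin n) : IsAlgebraic (paramRing (encode G)) (p i) := by
  refine isAlgebraic_of_fibre_finite (isSemialgebraic_coordSet (n := n) (m := m) (k := k) ω i) ?_ ?_
  · refine (Set.finite_singleton (p i)).subset fun t ht => ?_
    obtain ⟨x, hx, rfl⟩ := (cons_mem_coordSet_iff ω i _ t).1 ht
    rw [append_mem_optSet_iff, decode_encode] at hx
    rw [mem_singleton_iff, huniq x hx.1 hx.2]
  · exact (cons_mem_coordSet_iff ω i _ _).2
      ⟨p, (append_mem_optSet_iff ω _ p).2 ⟨by rwa [decode_encode], by rwa [decode_encode]⟩, rfl⟩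

/-- **Step (c) of the printed proof**: if the `nv` coordinates of `x` are algebraically independent
over `ℚ` and each is algebraic over `ℚ[θ]` for a parameter vector `θ ∈ ℝ^T`, then `nv ≤ T`
("`\overline{ℚ(Γ)}` contains `nv` algebraically independent elements. Thus, the transcendence degree
… is at least `nv`. Hence … `nv ≤ |Γ|`"). [cite: GouveiaRobinsonThomas2015, Thm. 2.1 proof (p05)] -/
theorem card_le_of_isAlgebraic_paramRing {T : ℕ} (θ : Fin T → ℝ) (x : Fin v → (Fin n → ℝ))
    (hind : AlgebraicIndependent ℚ fun p : Fin v × Fin n => x p.1 p.2)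
    (halg : ∀ i l, IsAlgebraic (paramRing θ) (x i l)) : n * v ≤ T := by
  classical
  set s : Set ℝ := Set.range fun p : Fin v × Fin n => x p.1 p.2 with hs
  -- `trdeg_ℚ ℚ[s] ≤ #(range θ) ≤ T`
  have h1 : Algebra.trdeg ℚ (Algebra.adjoin ℚ s) ≤ Cardinal.mk (Set.range θ) :=
    Literature.RingTheory.NoetherNormalization.trdeg_adjoin_le_of_forall_isAlgebraic (by
      rintro _ ⟨p, rfl⟩
      exact halg p.1 p.2)
  have h2 : Cardinal.mk (Set.range θ) ≤ (T : Cardinal) := by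
    simpa using (Cardinal.mk_range_le (f := θ))
  -- the coordinates, as elements of `ℚ[s]`, are algebraically independent
  have h3 : Cardinal.mk (Fin v × Fin n) ≤ Algebra.trdeg ℚ (Algebra.adjoin ℚ s) := by
    have hind' : AlgebraicIndependent ℚ fun p : Fin v × Fin n =>
        (⟨x p.1 p.2, Algebra.subset_adjoin ⟨p, rfl⟩⟩ : Algebra.adjoin ℚ s) :=
      AlgebraicIndependent.of_comp (Algebra.adjoin ℚ s).val hind
    exact hind'.cardinalMk_le_trdeg
  have h4 : ((n * v : ℕ) : Cardinal) ≤ (T : Cardinal) := by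
    calc ((n * v : ℕ) : Cardinal) = Cardinal.mk (Fin v × Fin n) := by
          rw [Cardinal.mk_fintype, Fintype.card_prod, Fintype.card_fin, Fintype.card_fin, mul_comm]
      _ ≤ _ := (h3.trans h1).trans h2
  exact_mod_cast h4

/-- Algebraic independence of all coordinates makes the points distinct (for `n ≥ 1`). [folklore] -/
private theorem injective_of_algebraicIndependent (hn : 1 ≤ n) (x : Fin v → (Fin n → ℝ))
    (hind : AlgebraicIndependent ℚ fun p : Fin v × Fin n => x p.1 p.2) :
    Function.Injective x := by
  intro j j' h
  have h1 : (fun p : Fin v × Fin n => x p.1 p.2) (j, ⟨0, hn⟩) =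
      (fun p : Fin v × Fin n => x p.1 p.2) (j', ⟨0, hn⟩) := by
    simp only [h]
  exact congrArg Prod.fst (hind.injective h1)

/-- **The count**: under the hypotheses of Theorem 2.1 (with `n ≥ 1`), `nv ≤ k⁴`.
[cite: GouveiaRobinsonThomas2015, Thm. 2.1 (p05)] -/
theorem mul_le_pow_four (hn : 1 ≤ n) (x : Fin v → (Fin n → ℝ))
    (hind : AlgebraicIndependent ℚ fun p : Fin v × Fin n => x p.1 p.2)
    (hext : ∀ i, x i ∈ (convexHull ℝ (Set.range x)).extremePoints ℝ)
    (hint : (interior (convexHull ℝ (Set.range x))).Nonempty)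
    (hk : HasPsdLift (convexHull ℝ (Set.range x)) k) : n * v ≤ k ^ 4 := by
  have hbd : Bornology.IsBounded (convexHull ℝ (Set.range x)) :=
    ((Set.finite_range x).isCompact_convexHull ℝ).isBounded
  obtain ⟨m, G, hcount, hmem⟩ := exists_normalForm hk hint hbd hn
  have hinj : Function.Injective x := injective_of_algebraicIndependent hn x hind
  -- every vertex coordinate is algebraic over `ℚ[entries of G]`
  have halg : ∀ i l, IsAlgebraic (paramRing (encode G)) (x i l) := by
    intro i l
    obtain ⟨ω, hω⟩ := exists_rat_strict x hinj i (hext i)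
    refine isAlgebraic_of_unique_optimum G ω ((hmem _).1 (subset_convexHull ℝ _ ⟨i, rfl⟩))
      (fun y hy => dotRat_le_of_mem_convexHull x i ω hω ((hmem y).2 hy)) (fun z hz hzmax => ?_) l
    exact eq_of_isMax_dotRat x i ω hω ((hmem z).2 hz)
      (hzmax (x i) ((hmem _).1 (subset_convexHull ℝ _ ⟨i, rfl⟩)))
  have hT : n * v ≤ nParams n m k := card_le_of_isAlgebraic_paramRing (encode G) x hind halg
  calc n * v ≤ nParams n m k := hT
    _ = (1 + n + m) * (k * k) := by rw [nParams, mul_assoc]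
    _ ≤ k ^ 2 * (k * k) := Nat.mul_le_mul_right _ hcount
    _ = k ^ 4 := by ring

end Assembly

end GenericPsdRank

/-- **Discharge of `GouveiaRobinsonThomas2015_thm21`** (GRT 2015, Theorem 2.1: "If `P ⊂ ℝⁿ` is a
generic polytope with `v` vertices, then its psd rank is at least `(nv)^{1/4}`"), through the
normal-form count `(1 + n + m)k² ≤ k⁴` for the lift data, the algebraicity of every vertex coordinate
over the field generated by the lift data (Tarski–Seidenberg over `ℚ` with parameters), and the
transcendence-degree bound. [cite: GouveiaRobinsonThomas2015, Thm. 2.1 (p05)] -/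
theorem GouveiaRobinsonThomas2015_thm21_holds : GouveiaRobinsonThomas2015_thm21 := by
  intro n v x hind hext hint k hk
  rcases Nat.eq_zero_or_pos n with hn0 | hn
  · subst hn0
    rw [Nat.cast_zero, zero_mul, Real.zero_rpow (by norm_num)]
    exact Nat.cast_nonneg k
  · have h := GenericPsdRank.mul_le_pow_four hn x hind hext hint hk
    have h' : ((n : ℝ) * v) ≤ (k : ℝ) ^ 4 := by exact_mod_cast h
    calc ((n : ℝ) * v) ^ (1 / 4 : ℝ) ≤ ((k : ℝ) ^ 4) ^ (1 / 4 : ℝ) :=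
          Real.rpow_le_rpow (by positivity) h' (by norm_num)
      _ = k := by
          rw [show (1 / 4 : ℝ) = ((4 : ℕ) : ℝ)⁻¹ by norm_num]
          exact Real.pow_rpow_inv_natCast (Nat.cast_nonneg k) (by norm_num)


namespace GenericPsdRank

/-! ### §6 The LP analogue: extension complexity of generic polytopes
(Fiorini–Rothvoß–Tiwary 2012, Theorem 3; Gouveia–Robinson–Thomas 2015, §2)

GRT 2015, p05: "It was shown in [FRT] that the nonnegative rank of a generic polygon with `v`
vertices is at least `√(2v)`. Their proof in fact extends to showing that the nonnegative rank of a
generic `n`-dimensional polytope with `v` vertices is at least `√(nv)`." FRT 2012, Theorem 3 (held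
text `paper:arxiv-1107.0371`, p07): "If `P` is a generic convex `n`-gon in `ℝ²` then `xc(P) ≥ √(2n)`",
proved there by counting the `k(d+1)` real numbers of a linear description of an extension with `k`
facets in `ℝ^d`, Cramer's rule (vertex coordinates are rational functions of them) and the
transcendence degree. Here: the slack-form extended formulations of the tree
(`Literature.Barriers.PneNP.HasEFOfSize`: `P = {x | ∃ y ≥ 0, E x + F y = g}`, `r` inequalities) are
brought to the normal form `P = {x | ∃ u, c₀ + Σ x_l c_l + Σ u_j c'_j ≥ 0}` with `1 + n + m ≤ r`
vectors of `ℝ^r` (so `≤ r²` parameters), and the same generic-fibre / optimum argument as in §§1–5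
(in place of Cramer's rule) gives `nv ≤ r²`. -/

section Family

variable {T n : ℕ}

/-- The index map `(θ, x, y) ↦ (θ, y)`, for parameters of any length `T`. [folklore] -/
def dropMid (T n : ℕ) : Fin (T + n) → Fin (T + n + n) :=
  Fin.append (fun s : Fin T => Fin.castAdd n (Fin.castAdd n s)) (fun l : Fin n => Fin.natAdd (T + n) l)

/-- `(θ, x, y) ↦ (θ, y)` on points. [folklore] -/
private theorem append_comp_dropMid (θ : Fin T → ℝ) (x y : Fin n → ℝ) :
    (Fin.append (Fin.append θ x) y) ∘ dropMid T n = Fin.append θ y := by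
  funext j
  refine Fin.addCases (fun s => ?_) (fun l => ?_) j
  · simp [dropMid]
  · simp [dropMid]

/-- `{(θ, x, y) | (θ, y) ∈ 𝒰, ⟨ω, x⟩ < ⟨ω, y⟩}` for an arbitrary family `𝒰`. [folklore] -/
def betterSetOf (𝒰 : Set (Fin (T + n) → ℝ)) (ω : Fin n → ℚ) : Set (Fin (T + n + n) → ℝ) :=
  ((fun w : Fin (T + n + n) → ℝ => w ∘ dropMid T n) ⁻¹' 𝒰) ∩
    {w | 0 < MvPolynomial.aeval w (∑ l : Fin n, MvPolynomial.C (ω l) *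
      (MvPolynomial.X (Fin.natAdd (T + n) l) - MvPolynomial.X (Fin.castAdd n (Fin.natAdd T l))))}

/-- `betterSetOf` is `ℚ`-semialgebraic when the family is. [folklore] -/
private theorem isSemialgebraic_betterSetOf {𝒰 : Set (Fin (T + n) → ℝ)} (h𝒰 : IsSemialgebraic ℚ 𝒰)
    (ω : Fin n → ℚ) : IsSemialgebraic ℚ (betterSetOf 𝒰 ω) :=
  (h𝒰.preimage_comp _).inter (isSemialgebraic_setOf_eval_pos _)

/-- Membership of `(θ, x, y)` in `betterSetOf`. [folklore] -/
private theorem append_mem_betterSetOf_iff (𝒰 : Set (Fin (T + n) → ℝ)) (ω : Fin n → ℚ)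
    (θ : Fin T → ℝ) (x y : Fin n → ℝ) :
    Fin.append (Fin.append θ x) y ∈ betterSetOf 𝒰 ω ↔
      Fin.append θ y ∈ 𝒰 ∧ dotRat ω x < dotRat ω y := by
  simp only [betterSetOf, mem_inter_iff, mem_preimage, append_comp_dropMid, mem_setOf_eq, map_sum,
    map_mul, map_sub, MvPolynomial.aeval_C, MvPolynomial.aeval_X, Fin.append_right, Fin.append_left,
    dotRat]
  simp only [eq_ratCast, mul_sub, Finset.sum_sub_distrib, sub_pos]

/-- **The optimum set of a rational functional over an arbitrary `ℚ`-semialgebraic family**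
`{(θ, x) ∈ 𝒰 | ⟨ω, y⟩ ≤ ⟨ω, x⟩ for all (θ, y) ∈ 𝒰}`. [folklore] -/
def optSetOf (𝒰 : Set (Fin (T + n) → ℝ)) (ω : Fin n → ℚ) : Set (Fin (T + n) → ℝ) :=
  𝒰 \ (fun w : Fin (T + n + n) → ℝ => fun i : Fin (T + n) => w (Fin.castAdd n i)) '' betterSetOf 𝒰 ω

/-- The optimum set is `ℚ`-semialgebraic (Tarski–Seidenberg over `ℚ`).
[cite: BochnakCosteRoy1998, Thm. 2.2.1] -/
theorem isSemialgebraic_optSetOf {𝒰 : Set (Fin (T + n) → ℝ)} (h𝒰 : IsSemialgebraic ℚ 𝒰)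
    (ω : Fin n → ℚ) : IsSemialgebraic ℚ (optSetOf 𝒰 ω) :=
  h𝒰.diff (isSemialgebraic_betterSetOf h𝒰 ω).image_castAdd

/-- Membership of `(θ, x)` in the optimum set. [folklore] -/
private theorem append_mem_optSetOf_iff (𝒰 : Set (Fin (T + n) → ℝ)) (ω : Fin n → ℚ)
    (θ : Fin T → ℝ) (x : Fin n → ℝ) :
    Fin.append θ x ∈ optSetOf 𝒰 ω ↔
      Fin.append θ x ∈ 𝒰 ∧ ∀ y, Fin.append θ y ∈ 𝒰 → dotRat ω y ≤ dotRat ω x := by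
  rw [optSetOf, Set.mem_sdiff, mem_image_castAdd_iff]
  simp only [append_mem_betterSetOf_iff, not_exists, not_and, not_lt]

/-- The index map `(θ, x) ↦ (x_i, θ)`, for parameters of any length `T`. [folklore] -/
def coordIdxOf (T n : ℕ) (i : Fin n) : Fin (T + 1) → Fin (T + n) :=
  Fin.cons (Fin.natAdd T i) fun s => Fin.castAdd n s

/-- `{(x_i, θ) | (θ, x) optimal}`. [folklore] -/
def coordSetOf (𝒰 : Set (Fin (T + n) → ℝ)) (ω : Fin n → ℚ) (i : Fin n) : Set (Fin (T + 1) → ℝ) :=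
  (fun w : Fin (T + n) → ℝ => w ∘ coordIdxOf T n i) '' optSetOf 𝒰 ω

/-- The coordinate image of the optimum set is `ℚ`-semialgebraic (Tarski–Seidenberg over `ℚ`).
[cite: BochnakCosteRoy1998, Thm. 2.2.1] -/
theorem isSemialgebraic_coordSetOf {𝒰 : Set (Fin (T + n) → ℝ)} (h𝒰 : IsSemialgebraic ℚ 𝒰)
    (ω : Fin n → ℚ) (i : Fin n) : IsSemialgebraic ℚ (coordSetOf 𝒰 ω i) :=
  (isSemialgebraic_optSetOf h𝒰 ω).image_comp _

/-- Membership of `(t, θ)` in the coordinate set. [folklore] -/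
private theorem cons_mem_coordSetOf_iff (𝒰 : Set (Fin (T + n) → ℝ)) (ω : Fin n → ℚ) (i : Fin n)
    (θ : Fin T → ℝ) (t : ℝ) :
    (Fin.cons t θ : Fin (T + 1) → ℝ) ∈ coordSetOf 𝒰 ω i ↔
      ∃ x : Fin n → ℝ, Fin.append θ x ∈ optSetOf 𝒰 ω ∧ x i = t := by
  constructor
  · rintro ⟨w, hw, hwt⟩
    refine ⟨fun l => w (Fin.natAdd T l), ?_, ?_⟩
    · have hθ : (fun s => w (Fin.castAdd n s)) = θ := by
        funext s
        have := congrFun hwt (Fin.succ s)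
        simpa [coordIdxOf] using this
      rw [← hθ, Fin.append_castAdd_natAdd]
      exact hw
    · have := congrFun hwt 0
      simpa [coordIdxOf] using this
  · rintro ⟨x, hx, rfl⟩
    refine ⟨Fin.append θ x, hx, ?_⟩
    funext j
    refine Fin.cases ?_ (fun s => ?_) j
    · simp [coordIdxOf]
    · simp [coordIdxOf]

/-- **Coordinates of unique optima over a `ℚ`-semialgebraic family are algebraic over the
parameters** (the abstract form of step (b): Tarski–Seidenberg with the family's parameters as
variables, then generic fibres). [cite: GouveiaRobinsonThomas2015, Thm. 2.1 proof (p05)]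
[cite: BochnakCosteRoy1998, Thm. 2.2.1] -/
theorem isAlgebraic_of_unique_optimum_of_family {𝒰 : Set (Fin (T + n) → ℝ)}
    (h𝒰 : IsSemialgebraic ℚ 𝒰) (ω : Fin n → ℚ) {θ : Fin T → ℝ} {p : Fin n → ℝ}
    (hp : Fin.append θ p ∈ 𝒰) (hmax : ∀ y, Fin.append θ y ∈ 𝒰 → dotRat ω y ≤ dotRat ω p)
    (huniq : ∀ x, Fin.append θ x ∈ 𝒰 → (∀ y, Fin.append θ y ∈ 𝒰 → dotRat ω y ≤ dotRat ω x) → x = p)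
    (i : Fin n) : IsAlgebraic (paramRing θ) (p i) := by
  refine isAlgebraic_of_fibre_finite (isSemialgebraic_coordSetOf h𝒰 ω i) ?_ ?_
  · refine (Set.finite_singleton (p i)).subset fun t ht => ?_
    obtain ⟨x, hx, rfl⟩ := (cons_mem_coordSetOf_iff 𝒰 ω i _ t).1 ht
    rw [append_mem_optSetOf_iff] at hx
    rw [mem_singleton_iff, huniq x hx.1 hx.2]
  · exact (cons_mem_coordSetOf_iff 𝒰 ω i _ _).2 ⟨p, (append_mem_optSetOf_iff 𝒰 ω _ p).2 ⟨hp, hmax⟩, rfl⟩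

end Family

section LpFamily

variable {c r n m : ℕ}

/-- The vector pencil `Σ_s z_s c_s ∈ ℝ^r`. [folklore] -/
def lpPencil (G : Fin c → (Fin r → ℝ)) (z : Fin c → ℝ) : Fin r → ℝ := ∑ s, z s • G s

/-- Entries of the vector pencil. [folklore] -/
private theorem lpPencil_apply (G : Fin c → (Fin r → ℝ)) (z : Fin c → ℝ) (i : Fin r) :
    lpPencil G z i = ∑ s, z s * G s i := by
  simp [lpPencil, Finset.sum_apply, Pi.smul_apply, smul_eq_mul]

/-- Position of the entry `i` of the `s`-th vector in the flattened parameter vector. [folklore] -/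
def vecIdx (c r : ℕ) : Fin c × Fin r ≃ Fin (c * r) := finProdFinEquiv

/-- The vectors encoded by a parameter vector. [folklore] -/
def decodeV (θ : Fin (c * r) → ℝ) : Fin c → (Fin r → ℝ) := fun s i => θ (vecIdx c r (s, i))

/-- The parameter vector of a tuple of vectors. [folklore] -/
def encodeV (G : Fin c → (Fin r → ℝ)) : Fin (c * r) → ℝ :=
  fun t => G ((vecIdx c r).symm t).1 ((vecIdx c r).symm t).2

/-- Decoding the parameter vector of a tuple of vectors returns the tuple. [folklore] -/
@[simp] private theorem decodeV_encodeV (G : Fin c → (Fin r → ℝ)) : decodeV (encodeV G) = G := by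
  funext s i
  simp [decodeV, encodeV]

/-- Number of real parameters of a normal-form extended formulation: `(1 + n + m)·r`.
[cite: FioriniRothvossTiwary2012, Thm. 3 proof (p07)] -/
abbrev nParamsLp (n m r : ℕ) : ℕ := (1 + n + m) * r

/-- Membership in `{x | ∃ u, c₀ + Σ x_l c_l + Σ u_j c'_j ≥ 0}`.
[cite: FioriniRothvossTiwary2012, Thm. 3 proof (p07)] -/
def LpLiftMem (G : Fin (1 + n + m) → (Fin r → ℝ)) (x : Fin n → ℝ) : Prop :=
  ∃ u : Fin m → ℝ, ∀ i, 0 ≤ lpPencil G (coefVec x u) i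

/-- The coefficient polynomials `(1, x, u)` in the variables `(θ, x, u)`. [folklore] -/
def coefPoly (T n m : ℕ) : Fin (1 + n + m) → MvPolynomial (Fin (T + n + m)) ℚ :=
  Fin.append (Fin.append (fun _ : Fin 1 => 1) (fun l => MvPolynomial.X (Fin.castAdd m (Fin.natAdd T l))))
    (fun j => MvPolynomial.X (Fin.natAdd (T + n) j))

/-- Evaluation of the coefficient polynomials at `(θ, x, u)` gives `(1, x, u)`. [folklore] -/
private theorem aeval_coefPoly {T : ℕ} (θ : Fin T → ℝ) (x : Fin n → ℝ) (u : Fin m → ℝ)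
    (s : Fin (1 + n + m)) :
    MvPolynomial.aeval (Fin.append (Fin.append θ x) u) (coefPoly T n m s) = coefVec x u s := by
  refine Fin.addCases (fun s' => ?_) (fun j => ?_) s
  · refine Fin.addCases (fun o => ?_) (fun l => ?_) s'
    · simp [coefPoly, coefVec]
    · simp [coefPoly, coefVec]
  · simp [coefPoly, coefVec]

/-- The graph set `{(θ, x, u) | ∀ i, Σ_s (1,x,u)_s θ_{s,i} ≥ 0}` — finitely many polynomial
inequalities with rational coefficients. [folklore] -/
def lpLiftGraph (n m r : ℕ) : Set (Fin (nParamsLp n m r + n + m) → ℝ) :=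
  ⋂ i ∈ (Finset.univ : Finset (Fin r)),
    {w | 0 ≤ MvPolynomial.aeval w (∑ s : Fin (1 + n + m), coefPoly (nParamsLp n m r) n m s *
      MvPolynomial.X (Fin.castAdd m (Fin.castAdd n (vecIdx (1 + n + m) r (s, i)))))}

/-- The graph set is `ℚ`-semialgebraic. [folklore] -/
private theorem isSemialgebraic_lpLiftGraph : IsSemialgebraic ℚ (lpLiftGraph n m r) :=
  IsSemialgebraic.biInter _ _ fun _ _ => isSemialgebraic_setOf_eval_nonneg _

/-- Membership of `(θ, x, u)` in the graph set. [folklore] -/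
private theorem append_mem_lpLiftGraph_iff (θ : Fin (nParamsLp n m r) → ℝ) (x : Fin n → ℝ)
    (u : Fin m → ℝ) :
    Fin.append (Fin.append θ x) u ∈ lpLiftGraph n m r ↔
      ∀ i, 0 ≤ lpPencil (decodeV θ) (coefVec x u) i := by
  simp only [lpLiftGraph, mem_iInter, Finset.mem_univ, true_implies, mem_setOf_eq, map_sum, map_mul,
    aeval_coefPoly, MvPolynomial.aeval_X, Fin.append_left, lpPencil_apply, decodeV]

/-- **The universal family of normal-form extended formulations**
`{(θ, x) | ∃ u, c₀(θ) + Σ x_l c_l(θ) + Σ u_j c'_j(θ) ≥ 0}`. [cite: FioriniRothvossTiwary2012, Thm. 3 proof (p07)] -/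
def lpLiftFamily (n m r : ℕ) : Set (Fin (nParamsLp n m r + n) → ℝ) :=
  (fun w : Fin (nParamsLp n m r + n + m) → ℝ => fun i : Fin (nParamsLp n m r + n) =>
    w (Fin.castAdd m i)) '' lpLiftGraph n m r

/-- The universal family of extended formulations is `ℚ`-semialgebraic (Tarski–Seidenberg over `ℚ`).
[cite: BochnakCosteRoy1998, Thm. 2.2.1] -/
theorem isSemialgebraic_lpLiftFamily : IsSemialgebraic ℚ (lpLiftFamily n m r) :=
  isSemialgebraic_lpLiftGraph.image_castAdd

/-- Membership of `(θ, x)` in the universal family. [folklore] -/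
private theorem append_mem_lpLiftFamily_iff (θ : Fin (nParamsLp n m r) → ℝ) (x : Fin n → ℝ) :
    Fin.append θ x ∈ lpLiftFamily n m r ↔ LpLiftMem (decodeV θ) x := by
  rw [lpLiftFamily, mem_image_castAdd_iff]
  simp only [append_mem_lpLiftGraph_iff, LpLiftMem]

/-- The vector pencil of the block tuple `(c₀, P, Q)` at `(1, x, u)`. [folklore] -/
private theorem lpPencil_append_coefVec (G₀ : Fin r → ℝ) (P : Fin n → (Fin r → ℝ))
    (Q : Fin m → (Fin r → ℝ)) (x : Fin n → ℝ) (u : Fin m → ℝ) :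
    lpPencil (Fin.append (Fin.append (fun _ : Fin 1 => G₀) P) Q) (coefVec x u) =
      G₀ + ∑ l, x l • P l + ∑ j, u j • Q j := by
  simp only [lpPencil, coefVec, Fin.sum_univ_add, Fin.append_left, Fin.append_right,
    Fin.sum_univ_one, one_smul]

end LpFamily

section LpNormalForm

variable {n r : ℕ}

open Literature.Barriers.PneNP (HasEFOfSize ExtendedFormulation)

/-- **Normal form of a bounded full-dimensional extended formulation.** If `C ⊆ ℝⁿ` (`n ≥ 1`) is
bounded with nonempty interior and `C = {x | ∃ y ≥ 0, E x + F y = g}` with `y ∈ ℝ^r`, then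
`C = {x | ∃ u ∈ ℝ^m, c₀ + Σ_l x_l c_l + Σ_j u_j c'_j ≥ 0}` for some vectors of `ℝ^r` with
`1 + n + m ≤ r` ("Without loss of generality … the projection is onto the two first coordinates";
here: `E` is injective because `C` is bounded, the feasible `y` form `ℝ^r_+ ∩ (y₁ + D)` with
`D = F⁻¹(range E)`, and `D = ℝ^r` would make `C` a translate of `ℝⁿ`).
[cite: FioriniRothvossTiwary2012, Thm. 3 proof (p07)] -/
theorem exists_lpNormalForm {C : Set (Fin n → ℝ)} (h : HasEFOfSize C r)
    (hint : (interior C).Nonempty) (hbd : Bornology.IsBounded C) (hn : 1 ≤ n) :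
    ∃ (m : ℕ) (G : Fin (1 + n + m) → (Fin r → ℝ)),
      1 + n + m ≤ r ∧ ∀ x, x ∈ C ↔ LpLiftMem G x := by
  classical
  obtain ⟨Q, rfl⟩ := h
  obtain ⟨x₁, hx₁⟩ := hint.mono interior_subset
  have hx₁' := hx₁
  simp only [ExtendedFormulation.projSet, mem_setOf_eq] at hx₁'
  obtain ⟨y₁, hy₁, hxy₁⟩ := hx₁'
  set E' : (Fin n → ℝ) →ₗ[ℝ] (Fin Q.k → ℝ) := Q.E.mulVecLin with hE'
  set F' : (Fin r → ℝ) →ₗ[ℝ] (Fin Q.k → ℝ) := Q.F.mulVecLin with hF'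
  have hE'v : ∀ x, E' x = Q.E *ᵥ x := fun x => rfl
  have hF'v : ∀ y, F' y = Q.F *ᵥ y := fun y => rfl
  -- `E` is injective since `C` is bounded
  have hEinj : LinearMap.ker E' = ⊥ := by
    rw [LinearMap.ker_eq_bot']
    intro v hv
    refine eq_zero_of_ray_subset hbd x₁ v fun t _ => ?_
    refine ⟨y₁, hy₁, ?_⟩
    rw [Matrix.mulVec_add, Matrix.mulVec_smul, ← hE'v v, hv, smul_zero, add_zero, hxy₁]
  obtain ⟨Einv, hEinv⟩ := E'.exists_leftInverse_of_injective hEinj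
  have hEinvx : ∀ x, Einv (E' x) = x := fun x => by
    have := LinearMap.congr_fun hEinv x
    simpa using this
  -- the direction `D = F⁻¹(range E)` with a basis
  let D : Submodule ℝ (Fin r → ℝ) := (LinearMap.range E').comap F'
  have hDmem : ∀ v, v ∈ D ↔ ∃ z, E' z = F' v := fun v => by
    simp only [D, Submodule.mem_comap, LinearMap.mem_range]
  set N : ℕ := Module.finrank ℝ D with hNdef
  let b : Module.Basis (Fin N) ℝ D := Module.finBasis ℝ D
  let β : (Fin N → ℝ) →ₗ[ℝ] (Fin r → ℝ) :=
    Fintype.linearCombination ℝ (fun t => (b t : Fin r → ℝ))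
  have hβ : ∀ w, β w = ∑ t, w t • (b t : Fin r → ℝ) := fun w =>
    Fintype.linearCombination_apply _ _ w
  have hβD : ∀ w, β w ∈ D := fun w => by
    rw [hβ]
    exact D.sum_mem fun t _ => D.smul_mem _ (b t).2
  have hβsurj : ∀ v ∈ D, ∃ w, β w = v := by
    intro v hv
    refine ⟨b.repr ⟨v, hv⟩, ?_⟩
    have h1 := congrArg Subtype.val (b.sum_repr ⟨v, hv⟩)
    rw [Submodule.coe_sum] at h1
    rw [hβ]
    simpa only [Submodule.coe_smul] using h1
  -- `C = x₁ + Λ W`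
  let Λ : (Fin N → ℝ) →ₗ[ℝ] (Fin n → ℝ) := -(Einv ∘ₗ F' ∘ₗ β)
  have hΛw : ∀ w, Λ w = -Einv (F' (β w)) := fun w => rfl
  have hC : Q.projSet = (fun w => x₁ + Λ w) '' {w | ∀ j, 0 ≤ (y₁ + β w) j} := by
    ext x
    simp only [ExtendedFormulation.projSet, mem_setOf_eq, mem_image]
    constructor
    · rintro ⟨y, hy, hxy⟩
      have hv : y - y₁ ∈ D := (hDmem _).2 ⟨x₁ - x, by
        rw [map_sub, map_sub, hE'v, hE'v, hF'v, hF'v]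
        have h1 := congrArg₂ (· - ·) hxy₁ hxy
        simp only [sub_self] at h1
        -- h1 : E x₁ + F y₁ - (E x + F y) = 0
        linear_combination (exp := 1) h1⟩
      obtain ⟨w, hw⟩ := hβsurj _ hv
      refine ⟨w, fun j => ?_, ?_⟩
      · rw [hw, Pi.add_apply, Pi.sub_apply, add_sub_cancel]
        exact hy j
      · rw [hΛw, hw, map_sub, map_sub, hF'v y, hF'v y₁]
        have hFy : Q.F *ᵥ y = Q.g - Q.E *ᵥ x := eq_sub_of_add_eq' hxy
        have hFy₁ : Q.F *ᵥ y₁ = Q.g - Q.E *ᵥ x₁ := eq_sub_of_add_eq' hxy₁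
        rw [hFy, hFy₁, ← map_sub, sub_sub_sub_cancel_left, ← hE'v, ← hE'v, ← map_sub, hEinvx]
        abel
    · rintro ⟨w, hw, rfl⟩
      obtain ⟨z, hz⟩ := (hDmem _).1 (hβD w)
      refine ⟨y₁ + β w, fun j => hw j, ?_⟩
      rw [hΛw, ← hz, hEinvx, Matrix.mulVec_add, Matrix.mulVec_add, ← hE'v, ← hE'v, ← hF'v,
        ← hF'v (β w), ← hz, map_neg]
      rw [hE'v, hF'v, ← hxy₁]
      abel
  have hΛ : Function.Surjective Λ :=
    surjective_of_interior_image_nonempty x₁ Λ _ (hC ▸ hint)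
  -- the count `1 + N ≤ r`
  have hcount : 1 + N ≤ r := by
    have hNr : N ≤ r := by
      have h1 := Submodule.finrank_le D
      rwa [Module.finrank_fin_fun] at h1
    by_contra hcon
    have hN : N = r := by omega
    have hD : D = ⊤ := Submodule.eq_top_of_finrank_eq (by rw [Module.finrank_fin_fun, ← hNdef, hN])
    obtain ⟨w₀, hw₀⟩ := hβsurj (fun _ => 1) (hD ▸ Submodule.mem_top)
    -- every `x₁ + Λ w` lies in `C`
    have hall : ∀ w, x₁ + Λ w ∈ Q.projSet := by
      intro w
      rw [hC]
      refine ⟨w + (∑ j, |β w j|) • w₀, fun j => ?_, ?_⟩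
      · rw [map_add, map_smul, hw₀, Pi.add_apply, Pi.add_apply, Pi.smul_apply, smul_eq_mul, mul_one]
        have h1 : -|β w j| ≤ β w j := neg_abs_le _
        have h2 : |β w j| ≤ ∑ j', |β w j'| :=
          Finset.single_le_sum (fun j' _ => abs_nonneg (β w j')) (Finset.mem_univ j)
        linarith [hy₁ j]
      · -- `Λ w₀ = 0` by the ray through `x₁`
        have hΛ0 : Λ w₀ = 0 := by
          refine eq_zero_of_ray_subset hbd x₁ (Λ w₀) fun t ht => ?_
          rw [hC]
          refine ⟨t • w₀, fun j => ?_, by dsimp only; rw [map_smul]⟩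
          rw [map_smul, hw₀, Pi.add_apply, Pi.smul_apply, smul_eq_mul, mul_one]
          linarith [hy₁ j]
        dsimp only
        rw [map_add, map_smul, hΛ0, smul_zero, add_zero]
    -- hence `C ⊇ x₁ + ℝⁿ`, which is unbounded
    have hray : ∀ t : ℝ, 0 ≤ t → x₁ + t • (fun _ : Fin n => (1 : ℝ)) ∈ Q.projSet := by
      intro t _
      obtain ⟨w, hw⟩ := hΛ (t • fun _ => (1 : ℝ))
      rw [← hw]
      exact hall w
    have h0 := congrFun (eq_zero_of_ray_subset hbd x₁ _ hray) ⟨0, hn⟩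
    simp at h0
  -- coordinates adapted to `Λ`
  obtain ⟨R, hR⟩ := Λ.exists_rightInverse_of_surjective (LinearMap.range_eq_top.2 hΛ)
  have hRx : ∀ x, Λ (R x) = x := fun x => by
    have := LinearMap.congr_fun hR x
    simpa using this
  let K : Submodule ℝ (Fin N → ℝ) := LinearMap.ker Λ
  set m : ℕ := Module.finrank ℝ K with hmdef
  let bK : Module.Basis (Fin m) ℝ K := Module.finBasis ℝ K
  let κ : (Fin m → ℝ) →ₗ[ℝ] (Fin N → ℝ) :=
    Fintype.linearCombination ℝ (fun j => (bK j : Fin N → ℝ))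
  have hκ : ∀ u, κ u = ∑ j, u j • (bK j : Fin N → ℝ) := fun u =>
    Fintype.linearCombination_apply _ _ u
  have hκ0 : ∀ u, Λ (κ u) = 0 := fun u => by
    rw [hκ, map_sum]
    exact Finset.sum_eq_zero fun j _ => by rw [map_smul, LinearMap.mem_ker.1 (bK j).2, smul_zero]
  have hdecomp : ∀ w, ∃ u, R (Λ w) + κ u = w := by
    intro w
    have hv : w - R (Λ w) ∈ K := by
      rw [LinearMap.mem_ker, map_sub, hRx, sub_self]
    refine ⟨bK.repr ⟨w - R (Λ w), hv⟩, ?_⟩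
    have hsum : ∑ j, (bK.repr ⟨w - R (Λ w), hv⟩) j • (bK j : Fin N → ℝ) = w - R (Λ w) := by
      have h1 := congrArg Subtype.val (bK.sum_repr ⟨w - R (Λ w), hv⟩)
      rw [Submodule.coe_sum] at h1
      simpa only [Submodule.coe_smul] using h1
    rw [hκ, hsum, add_sub_cancel]
  have hnm : n + m = N := by
    have h1 := LinearMap.finrank_range_add_finrank_ker Λ
    rw [LinearMap.range_eq_top.2 hΛ, finrank_top, Module.finrank_fin_fun,
      Module.finrank_fin_fun] at h1
    exact h1
  -- the vectors
  let G₀ : Fin r → ℝ := y₁ - β (R x₁)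
  let P : Fin n → (Fin r → ℝ) := fun l => β (R fun j => if l = j then 1 else 0)
  let Qv : Fin m → (Fin r → ℝ) := fun j => β (κ fun j' => if j = j' then 1 else 0)
  have hpen : ∀ (x : Fin n → ℝ) (u : Fin m → ℝ),
      lpPencil (Fin.append (Fin.append (fun _ : Fin 1 => G₀) P) Qv) (coefVec x u) =
        y₁ + β (R (x - x₁) + κ u) := by
    intro x u
    rw [lpPencil_append_coefVec]
    have h1 : ∑ l, x l • P l = β (R x) := by
      have := LinearMap.pi_apply_eq_sum_univ (β ∘ₗ R) x
      rw [LinearMap.comp_apply] at this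
      rw [this]
      rfl
    have h2 : ∑ j, u j • Qv j = β (κ u) := by
      have := LinearMap.pi_apply_eq_sum_univ (β ∘ₗ κ) u
      rw [LinearMap.comp_apply] at this
      rw [this]
      rfl
    rw [h1, h2]
    simp only [G₀, map_add, map_sub]
    abel
  refine ⟨m, Fin.append (Fin.append (fun _ : Fin 1 => G₀) P) Qv, by rw [add_assoc, hnm]; exact hcount,
    fun x => ?_⟩
  rw [hC]
  constructor
  · rintro ⟨w, hw, rfl⟩
    obtain ⟨u, hu⟩ := hdecomp w
    refine ⟨u, fun i => ?_⟩
    rw [hpen, add_sub_cancel_left, hu]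
    exact hw i
  · rintro ⟨u, hu⟩
    refine ⟨R (x - x₁) + κ u, fun j => ?_, ?_⟩
    · rw [← hpen]
      exact hu j
    · show x₁ + Λ (R (x - x₁) + κ u) = x
      rw [map_add, hRx, hκ0, add_zero, add_sub_cancel]

end LpNormalForm

section LpAssembly

variable {n m r v : ℕ}

open Literature.Barriers.PneNP (HasEFOfSize)

/-- **The count for extended formulations**: under the hypotheses of FRT Theorem 3 / GRT §2 (with
`n ≥ 1`), `nv ≤ r²` for every extended formulation with `r` inequalities ("`k(d+1) ≥ 2n`. Because
`k ≥ d+1`, we see that `k² ≥ 2n`"). [cite: FioriniRothvossTiwary2012, Thm. 3 proof (p07)]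
[cite: GouveiaRobinsonThomas2015, §2 (p05)] -/
theorem mul_le_sq_of_hasEFOfSize (hn : 1 ≤ n) (x : Fin v → (Fin n → ℝ))
    (hind : AlgebraicIndependent ℚ fun p : Fin v × Fin n => x p.1 p.2)
    (hext : ∀ i, x i ∈ (convexHull ℝ (Set.range x)).extremePoints ℝ)
    (hint : (interior (convexHull ℝ (Set.range x))).Nonempty)
    (hr : HasEFOfSize (convexHull ℝ (Set.range x)) r) : n * v ≤ r ^ 2 := by
  have hbd : Bornology.IsBounded (convexHull ℝ (Set.range x)) :=
    ((Set.finite_range x).isCompact_convexHull ℝ).isBounded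
  obtain ⟨m, G, hcount, hmem⟩ := exists_lpNormalForm hr hint hbd hn
  have hinj : Function.Injective x := injective_of_algebraicIndependent hn x hind
  have h𝒰 := isSemialgebraic_lpLiftFamily (n := n) (m := m) (r := r)
  have hmem' : ∀ y, Fin.append (encodeV G) y ∈ lpLiftFamily n m r ↔ y ∈ convexHull ℝ (Set.range x) :=
    fun y => by rw [append_mem_lpLiftFamily_iff, decodeV_encodeV, hmem]
  have halg : ∀ i l, IsAlgebraic (paramRing (encodeV G)) (x i l) := by
    intro i l
    obtain ⟨ω, hω⟩ := exists_rat_strict x hinj i (hext i)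
    refine isAlgebraic_of_unique_optimum_of_family h𝒰 ω
      ((hmem' _).2 (subset_convexHull ℝ _ ⟨i, rfl⟩))
      (fun y hy => dotRat_le_of_mem_convexHull x i ω hω ((hmem' y).1 hy)) (fun z hz hzmax => ?_) l
    exact eq_of_isMax_dotRat x i ω hω ((hmem' z).1 hz)
      (hzmax (x i) ((hmem' _).2 (subset_convexHull ℝ _ ⟨i, rfl⟩)))
  have hT : n * v ≤ nParamsLp n m r := card_le_of_isAlgebraic_paramRing (encodeV G) x hind halg
  calc n * v ≤ nParamsLp n m r := hT
    _ = (1 + n + m) * r := rfl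
    _ ≤ r * r := Nat.mul_le_mul_right _ hcount
    _ = r ^ 2 := (sq r).symm

end LpAssembly

end GenericPsdRank

section LpTheorems

open Literature.Barriers.PneNP (HasEFOfSize)

/-- **Fiorini–Rothvoß–Tiwary 2012, Theorem 3** (p07, verbatim): "If `P` is a generic convex `n`-gon
in `ℝ²` then `xc(P) ≥ √(2n)`", a polygon being *generic* when "the coordinates of its vertices are
distinct and form a set that is algebraically independent over the rationals" (p07). Typed like the
tree's `GouveiaRobinsonThomas2015_thm21`: `v` points of `ℝ²` with algebraically independent
coordinates (hence distinct), each a vertex of the full-dimensional polygon `conv{x_i}`; every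
extended formulation (`HasEFOfSize`, size = number of inequalities, = `xc` by Yannakakis) has size
`r ≥ √(2v)`. PROVED (normal form with `≤ r²` parameters, Tarski–Seidenberg with parameters in place
of the printed Cramer's rule, transcendence degree). [cite: FioriniRothvossTiwary2012, Thm. 3 (p07)] -/
theorem FioriniRothvossTiwary2012_thm3 (v : ℕ) (x : Fin v → (Fin 2 → ℝ))
    (hind : AlgebraicIndependent ℚ fun p : Fin v × Fin 2 => x p.1 p.2)
    (hext : ∀ i, x i ∈ (convexHull ℝ (Set.range x)).extremePoints ℝ)
    (hint : (interior (convexHull ℝ (Set.range x))).Nonempty)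
    (r : ℕ) (hr : HasEFOfSize (convexHull ℝ (Set.range x)) r) : Real.sqrt (2 * v) ≤ r := by
  have h := GenericPsdRank.mul_le_sq_of_hasEFOfSize (by norm_num) x hind hext hint hr
  have h' : (2 : ℝ) * v ≤ (r : ℝ) ^ 2 := by exact_mod_cast h
  calc Real.sqrt (2 * v) ≤ Real.sqrt ((r : ℝ) ^ 2) := Real.sqrt_le_sqrt h'
    _ = r := Real.sqrt_sq (Nat.cast_nonneg r)

/-- **Gouveia–Robinson–Thomas 2015, §2 (p05)**: "Their proof in fact extends to showing that the
nonnegative rank of a generic `n`-dimensional polytope with `v` vertices is at least `√(nv)`" — for a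
generic full-dimensional polytope with `v` vertices in `ℝⁿ`, every extended formulation has at least
`√(nv)` inequalities. PROVED. [cite: GouveiaRobinsonThomas2015, §2 (p05)]
[cite: FioriniRothvossTiwary2012, Thm. 3 (p07)] -/
theorem GouveiaRobinsonThomas2015_xc_generic (n v : ℕ) (x : Fin v → (Fin n → ℝ))
    (hind : AlgebraicIndependent ℚ fun p : Fin v × Fin n => x p.1 p.2)
    (hext : ∀ i, x i ∈ (convexHull ℝ (Set.range x)).extremePoints ℝ)
    (hint : (interior (convexHull ℝ (Set.range x))).Nonempty)
    (r : ℕ) (hr : HasEFOfSize (convexHull ℝ (Set.range x)) r) : Real.sqrt (n * v) ≤ r := by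
  rcases Nat.eq_zero_or_pos n with hn0 | hn
  · subst hn0
    rw [Nat.cast_zero, zero_mul, Real.sqrt_zero]
    exact Nat.cast_nonneg r
  · have h := GenericPsdRank.mul_le_sq_of_hasEFOfSize hn x hind hext hint hr
    have h' : (n : ℝ) * v ≤ (r : ℝ) ^ 2 := by exact_mod_cast h
    calc Real.sqrt (n * v) ≤ Real.sqrt ((r : ℝ) ^ 2) := Real.sqrt_le_sqrt h'
      _ = r := Real.sqrt_sq (Nat.cast_nonneg r)

end LpTheorems


namespace GenericPsdRank

/-! ### §7 The printed count `nv ≤ |Γ| ≤ d_k²`, `d_k = k(k+1)/2`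

The proof of Theorem 2.1 (p05) bounds `nv` by the number `|Γ| ≤ d_k²` of real entries of the
`d_k` SYMMETRIC matrices `G_1, …, G_{d_k}` (`d_k = k(k+1)/2` distinct entries each) before weakening
to `k⁴`. This section records that sharper printed inequality: parametrising the normal form by the
upper-triangular entries of its (symmetric) matrices and counting `1 + n + m ≤ d_k` (the symmetric
part of the direction of `L` is a PROPER subspace of the symmetric matrices for a bounded
full-dimensional `C`), `nv ≤ d_k²`. -/

section SymFamily

variable {c k n m : ℕ}

/-- The number of distinct entries of a symmetric `k × k` matrix, as the cardinality of the unordered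
index pairs. [cite: GouveiaRobinsonThomas2015, Thm. 2.1 proof (p05, d_k)] -/
abbrev dSym (k : ℕ) : ℕ := Fintype.card (Sym2 (Fin k))

/-- `d_k = C(k+1, 2)`. [cite: GouveiaRobinsonThomas2015, Thm. 2.1 proof (p05, d_k = k(k+1)/2)] -/
theorem dSym_eq_choose (k : ℕ) : dSym k = (k + 1).choose 2 := by
  rw [dSym, Sym2.card, Fintype.card_fin]

/-- Position of the entry `{a, b}` of the `r`-th symmetric matrix among `c·d_k` parameters. [folklore] -/
def symFlat (c k : ℕ) : Fin c × Sym2 (Fin k) ≃ Fin (c * dSym k) :=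
  (Equiv.prodCongr (Equiv.refl (Fin c)) (Fintype.equivFin (Sym2 (Fin k)))).trans finProdFinEquiv

/-- The symmetric matrices encoded by a parameter vector. [folklore] -/
def decodeS (θ : Fin (c * dSym k) → ℝ) : Fin c → Matrix (Fin k) (Fin k) ℝ :=
  fun r => Matrix.of fun a b => θ (symFlat c k (r, s(a, b)))

/-- The parameter vector of a tuple of symmetric matrices (`c·d_k` entries). [folklore] -/
def encodeS (G : Fin c → Matrix (Fin k) (Fin k) ℝ) : Fin (c * dSym k) → ℝ :=
  fun t => G ((symFlat c k).symm t).1 ((symFlat c k).symm t).2.inf ((symFlat c k).symm t).2.sup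

/-- Decoding the parameter vector of a tuple of SYMMETRIC matrices returns the tuple. [folklore] -/
private theorem decodeS_encodeS {G : Fin c → Matrix (Fin k) (Fin k) ℝ} (hG : ∀ r, (G r).IsSymm) :
    decodeS (encodeS G) = G := by
  funext r
  ext a b
  simp only [decodeS, encodeS, Matrix.of_apply, Equiv.symm_apply_apply, Sym2.inf_mk, Sym2.sup_mk]
  rcases le_total a b with h | h
  · rw [min_eq_left h, max_eq_right h]
  · rw [min_eq_right h, max_eq_left h]
    exact (hG r).apply a b

/-- The universal symmetric pencil set `{(θ, z) | Σ_r z_r G_r(θ) ⪰ 0}`, `θ ∈ ℝ^{c d_k}`. [folklore] -/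
def pencilSetS (c k : ℕ) : Set (Fin (c * dSym k + c) → ℝ) :=
  {w | (pencil (decodeS fun s => w (Fin.castAdd c s)) fun r => w (Fin.natAdd (c * dSym k) r)).PosSemidef}

/-- The symbolic symmetric pencil. [folklore] -/
def symbPencilS (c k : ℕ) : Matrix (Fin k) (Fin k) (MvPolynomial (Fin (c * dSym k + c)) ℚ) :=
  Matrix.of fun a b => ∑ r : Fin c,
    MvPolynomial.X (Fin.natAdd (c * dSym k) r) * MvPolynomial.X (Fin.castAdd c (symFlat c k (r, s(a, b))))

/-- The symbolic symmetric pencil evaluates to the pencil of the decoded matrices. [folklore] -/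
private theorem symbPencilS_map_aeval (w : Fin (c * dSym k + c) → ℝ) :
    (symbPencilS c k).map (MvPolynomial.aeval w) =
      pencil (decodeS fun s => w (Fin.castAdd c s)) fun r => w (Fin.natAdd (c * dSym k) r) := by
  ext a b
  simp [symbPencilS, pencil_apply, decodeS, map_sum, map_mul, MvPolynomial.aeval_X]

/-- The universal symmetric pencil set is `ℚ`-semialgebraic. [folklore] -/
private theorem isSemialgebraic_pencilSetS : IsSemialgebraic ℚ (pencilSetS c k) := by
  have h := isSemialgebraic_setOf_posSemidef (symbPencilS c k)
  convert h using 1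
  ext w
  simp only [pencilSetS, mem_setOf_eq, symbPencilS_map_aeval]

/-- Number of real parameters of a symmetric normal-form lift: `(1 + n + m)·d_k`.
[cite: GouveiaRobinsonThomas2015, Thm. 2.1 proof (p05, |Γ| ≤ d_k²)] -/
abbrev nParamsS (n m k : ℕ) : ℕ := (1 + n + m) * dSym k

/-- The graph set `{(θ, x, u) | G₀(θ) + Σ x_l G_l(θ) + Σ u_j G'_j(θ) ⪰ 0}` with symmetric parameters.
[folklore] -/
def liftGraphS (n m k : ℕ) : Set (Fin (nParamsS n m k + n + m) → ℝ) :=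
  (fun w => fun j => MvPolynomial.aeval w
    ((Fin.append (fun s => MvPolynomial.X (Fin.castAdd m (Fin.castAdd n s)))
      (coefPoly (nParamsS n m k) n m) : Fin (nParamsS n m k + (1 + n + m)) → _) j)) ⁻¹'
    pencilSetS (1 + n + m) k

/-- The graph set is `ℚ`-semialgebraic. [folklore] -/
private theorem isSemialgebraic_liftGraphS : IsSemialgebraic ℚ (liftGraphS n m k) :=
  isSemialgebraic_pencilSetS.preimage_aeval _

/-- Membership of `(θ, x, u)` in the graph set. [folklore] -/
private theorem append_mem_liftGraphS_iff (θ : Fin (nParamsS n m k) → ℝ) (x : Fin n → ℝ)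
    (u : Fin m → ℝ) :
    Fin.append (Fin.append θ x) u ∈ liftGraphS n m k ↔
      (pencil (decodeS θ) (coefVec x u)).PosSemidef := by
  have heval : (fun j => MvPolynomial.aeval (Fin.append (Fin.append θ x) u)
      ((Fin.append (fun s => MvPolynomial.X (Fin.castAdd m (Fin.castAdd n s)))
        (coefPoly (nParamsS n m k) n m) : Fin (nParamsS n m k + (1 + n + m)) → _) j)) =
      Fin.append θ (coefVec x u) := by
    funext j
    refine Fin.addCases (fun s => ?_) (fun r => ?_) j
    · simp
    · simp only [Fin.append_right, aeval_coefPoly]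
  simp only [liftGraphS, mem_preimage, heval, pencilSetS, mem_setOf_eq, Fin.append_left,
    Fin.append_right]

/-- The universal family of symmetric normal-form lifts. [folklore] -/
def liftFamilyS (n m k : ℕ) : Set (Fin (nParamsS n m k + n) → ℝ) :=
  (fun w : Fin (nParamsS n m k + n + m) → ℝ => fun i : Fin (nParamsS n m k + n) =>
    w (Fin.castAdd m i)) '' liftGraphS n m k

/-- The universal family of symmetric normal-form lifts is `ℚ`-semialgebraic (Tarski–Seidenberg
over `ℚ`). [cite: BochnakCosteRoy1998, Thm. 2.2.1] -/
theorem isSemialgebraic_liftFamilyS : IsSemialgebraic ℚ (liftFamilyS n m k) :=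
  isSemialgebraic_liftGraphS.image_castAdd

/-- Membership of `(θ, x)` in the symmetric universal family. [folklore] -/
private theorem append_mem_liftFamilyS_iff (θ : Fin (nParamsS n m k) → ℝ) (x : Fin n → ℝ) :
    Fin.append θ x ∈ liftFamilyS n m k ↔ LiftMem (decodeS θ) x := by
  rw [liftFamilyS, mem_image_castAdd_iff]
  simp only [append_mem_liftGraphS_iff, LiftMem]

end SymFamily

section SharpNormalForm

variable {n k : ℕ}

open Literature.LinearAlgebra.Matrix (symmetricSubmodule mem_symmetricSubmodule
  finrank_symmetricSubmodule_eq_choose)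

/-- A symmetric matrix shifted by the sum of the absolute values of its entries times the identity
is positive semidefinite (`xᵀSx ≥ −(Σ|S_ab|)‖x‖²`). [folklore] -/
private theorem posSemidef_add_sum_abs_smul_one {S : Matrix (Fin k) (Fin k) ℝ} (hS : S.IsSymm) :
    (S + (∑ a, ∑ b, |S a b|) • (1 : Matrix (Fin k) (Fin k) ℝ)).PosSemidef := by
  classical
  set c : ℝ := ∑ a, ∑ b, |S a b| with hc
  refine Matrix.PosSemidef.of_dotProduct_mulVec_nonneg ?_ fun x => ?_
  · rw [Matrix.isHermitian_iff_isSymm]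
    exact hS.add ((Matrix.isSymm_one).smul c)
  · have hxx : ∀ a, x a ^ 2 ≤ x ⬝ᵥ x := fun a => by
      rw [dotProduct]
      have := Finset.single_le_sum (f := fun i => x i * x i) (fun i _ => mul_self_nonneg (x i))
        (Finset.mem_univ a)
      simpa [pow_two] using this
    have hq : ∀ a b, -(|S a b| * (x ⬝ᵥ x)) ≤ S a b * (x a * x b) := by
      intro a b
      have h1 : |x a * x b| ≤ x ⬝ᵥ x := by
        rw [abs_mul]
        have h2 := two_mul_le_add_sq |x a| |x b|
        rw [sq_abs, sq_abs] at h2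
        nlinarith [hxx a, hxx b, abs_nonneg (x a), abs_nonneg (x b)]
      have h3 : -(|S a b| * |x a * x b|) ≤ S a b * (x a * x b) := by
        rw [← abs_mul]
        exact neg_abs_le _
      nlinarith [abs_nonneg (S a b)]
    have hsum : -(c * (x ⬝ᵥ x)) ≤ x ⬝ᵥ (S *ᵥ x) := by
      have h1 : x ⬝ᵥ (S *ᵥ x) = ∑ a, ∑ b, S a b * (x a * x b) := by
        simp only [dotProduct, Matrix.mulVec, Finset.mul_sum]
        exact Finset.sum_congr rfl fun a _ => Finset.sum_congr rfl fun b _ => by ring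
      have h2 : -(c * (x ⬝ᵥ x)) = ∑ a, ∑ b, -(|S a b| * (x ⬝ᵥ x)) := by
        rw [hc, Finset.sum_mul, ← Finset.sum_neg_distrib]
        refine Finset.sum_congr rfl fun a _ => ?_
        rw [Finset.sum_mul, ← Finset.sum_neg_distrib]
      rw [h1, h2]
      exact Finset.sum_le_sum fun a _ => Finset.sum_le_sum fun b _ => hq a b
    have hx : star x = x := funext fun i => star_trivial (x i)
    rw [hx, Matrix.add_mulVec, dotProduct_add, Matrix.smul_mulVec, Matrix.one_mulVec,
      dotProduct_smul, smul_eq_mul]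
    linarith

/-- **Normal form with the printed count.** If `C ⊆ ℝⁿ` (`n ≥ 1`) is bounded with nonempty
interior and has a psd lift of size `k`, then `C = {x | ∃ u ∈ ℝ^m, G₀ + Σ_l x_l G_l + Σ_j u_j G'_j ⪰ 0}`
with SYMMETRIC `k × k` matrices and `1 + n + m ≤ d_k = k(k+1)/2` (the symmetric part `D` of the
direction of `L` is a proper subspace of the symmetric matrices: `D = Sym_k` would put `a₀ + Λ w` in
`C` for every `w`, since every symmetric matrix is a difference of two positive semidefinite ones,
making `C` a point or unbounded). [cite: GouveiaRobinsonThomas2015, Thm. 2.1 proof (p05, |Γ| ≤ d_k²)] -/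
theorem exists_normalForm_symm {C : Set (Fin n → ℝ)} (h : HasPsdLift C k)
    (hint : (interior C).Nonempty) (hbd : Bornology.IsBounded C) (hn : 1 ≤ n) :
    ∃ (m : ℕ) (G : Fin (1 + n + m) → Matrix (Fin k) (Fin k) ℝ),
      1 + n + m ≤ dSym k ∧ (∀ r, (G r).IsSymm) ∧ ∀ x, x ∈ C ↔ LiftMem G x := by
  classical
  obtain ⟨L, π, rfl⟩ := h
  obtain ⟨-, M₁, ⟨hM₁, hM₁L⟩, -⟩ := hint.mono interior_subset
  -- the symmetric part of the direction of `L`, with a basis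
  let D : Submodule ℝ (Matrix (Fin k) (Fin k) ℝ) :=
    { carrier := {v | v ∈ L.direction ∧ vᵀ = v}
      add_mem' := fun {a b} ha hb =>
        ⟨L.direction.add_mem ha.1 hb.1, by rw [Matrix.transpose_add, ha.2, hb.2]⟩
      zero_mem' := ⟨L.direction.zero_mem, Matrix.transpose_zero⟩
      smul_mem' := fun c {v} hv =>
        ⟨L.direction.smul_mem c hv.1, by rw [Matrix.transpose_smul, hv.2]⟩ }
  have hDmem : ∀ v, v ∈ D ↔ v ∈ L.direction ∧ vᵀ = v := fun v => Iff.rfl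
  set N : ℕ := Module.finrank ℝ D with hNdef
  let b : Module.Basis (Fin N) ℝ D := Module.finBasis ℝ D
  let β : (Fin N → ℝ) →ₗ[ℝ] Matrix (Fin k) (Fin k) ℝ :=
    Fintype.linearCombination ℝ (fun t => (b t : Matrix (Fin k) (Fin k) ℝ))
  have hβ : ∀ w, β w = ∑ t, w t • (b t : Matrix (Fin k) (Fin k) ℝ) := fun w =>
    Fintype.linearCombination_apply _ _ w
  have hβD : ∀ w, β w ∈ D := fun w => by
    rw [hβ]
    exact D.sum_mem fun t _ => D.smul_mem _ (b t).2
  have hβsurj : ∀ v ∈ D, ∃ w, β w = v := by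
    intro v hv
    refine ⟨b.repr ⟨v, hv⟩, ?_⟩
    have h1 := congrArg Subtype.val (b.sum_repr ⟨v, hv⟩)
    rw [Submodule.coe_sum] at h1
    rw [hβ]
    simpa only [Submodule.coe_smul] using h1
  have hM₁s : M₁ᵀ = M₁ := (Matrix.isHermitian_iff_isSymm.1 hM₁.1).eq
  -- `S^k_+ ∩ L = {M₁ + β w ⪰ 0}`
  have hSL : ∀ M, (M.PosSemidef ∧ M ∈ L) ↔ ∃ w, (M₁ + β w).PosSemidef ∧ M = M₁ + β w := by
    intro M
    constructor
    · rintro ⟨hM, hML⟩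
      have hv : M - M₁ ∈ D := (hDmem _).2 ⟨AffineSubspace.vsub_mem_direction hML hM₁L, by
        rw [Matrix.transpose_sub, (Matrix.isHermitian_iff_isSymm.1 hM.1).eq, hM₁s]⟩
      obtain ⟨w, hw⟩ := hβsurj _ hv
      refine ⟨w, ?_, ?_⟩
      · rw [hw, add_sub_cancel]
        exact hM
      · rw [hw, add_sub_cancel]
    · rintro ⟨w, hw, rfl⟩
      refine ⟨hw, ?_⟩
      have hdir : β w ∈ L.direction := ((hDmem _).1 (hβD w)).1
      have h1 := AffineSubspace.vadd_mem_of_mem_direction hdir hM₁L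
      rwa [vadd_eq_add, add_comm] at h1
  -- `C = a₀ + Λ W`
  set a₀ : Fin n → ℝ := π M₁ with ha₀
  let Λ : (Fin N → ℝ) →ₗ[ℝ] (Fin n → ℝ) := π ∘ₗ β
  have hΛw : ∀ w, Λ w = π (β w) := fun w => rfl
  have hC : π '' {M | M.PosSemidef ∧ M ∈ L} =
      (fun w => a₀ + Λ w) '' {w | (M₁ + β w).PosSemidef} := by
    ext y
    simp only [mem_image, mem_setOf_eq]
    constructor
    · rintro ⟨M, hM, rfl⟩
      obtain ⟨w, hw, rfl⟩ := (hSL M).1 hM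
      exact ⟨w, hw, by rw [map_add, hΛw]⟩
    · rintro ⟨w, hw, rfl⟩
      exact ⟨M₁ + β w, (hSL _).2 ⟨w, hw, rfl⟩, by rw [map_add, hΛw]⟩
  have hΛ : Function.Surjective Λ :=
    surjective_of_interior_image_nonempty a₀ Λ _ (hC ▸ hint)
  -- the count `1 + N ≤ d_k`: `D` is a proper subspace of the symmetric matrices
  have hDle : D ≤ symmetricSubmodule (Fin k) ℝ := fun v hv => by
    rw [mem_symmetricSubmodule]
    exact ((hDmem v).1 hv).2
  have hcount : 1 + N ≤ dSym k := by
    have hNle : N ≤ Module.finrank ℝ (symmetricSubmodule (Fin k) ℝ) := Submodule.finrank_mono hDle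
    have hdS : Module.finrank ℝ (symmetricSubmodule (Fin k) ℝ) = dSym k := by
      rw [finrank_symmetricSubmodule_eq_choose, Fintype.card_fin, dSym_eq_choose]
    rw [hdS] at hNle
    by_contra hcon
    have hN : N = dSym k := by omega
    have hD : D = symmetricSubmodule (Fin k) ℝ :=
      Submodule.eq_of_le_of_finrank_eq hDle (by rw [← hNdef, hN, hdS])
    -- every symmetric matrix is `β w`; psd ones give rays, so `Λ` kills them
    have hray : ∀ w, (β w).PosSemidef → Λ w = 0 := by
      intro w hw
      refine eq_zero_of_ray_subset hbd a₀ (Λ w) fun t ht => ?_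
      rw [hC]
      refine ⟨t • w, ?_, by dsimp only; rw [map_smul]⟩
      show (M₁ + β (t • w)).PosSemidef
      rw [map_smul]
      exact hM₁.add (hw.smul ht)
    -- hence `Λ = 0`: write `β w = (β w + c•1) − c•1`
    have hΛ0 : ∀ w, Λ w = 0 := by
      intro w
      have hsym : (β w).IsSymm := ((hDmem _).1 (hβD w)).2
      set cst : ℝ := ∑ a, ∑ b', |β w a b'| with hcst
      have hc0 : 0 ≤ cst := Finset.sum_nonneg fun a _ => Finset.sum_nonneg fun b' _ => abs_nonneg _
      have h1mem : (cst • (1 : Matrix (Fin k) (Fin k) ℝ)) ∈ D := by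
        rw [hD, mem_symmetricSubmodule]
        exact (Matrix.isSymm_one).smul cst
      have h2mem : β w + cst • (1 : Matrix (Fin k) (Fin k) ℝ) ∈ D := D.add_mem (hβD w) h1mem
      obtain ⟨w₁, hw₁⟩ := hβsurj _ h2mem
      obtain ⟨w₂, hw₂⟩ := hβsurj _ h1mem
      have hΛ₁ : Λ w₁ = 0 := hray w₁ (by rw [hw₁]; exact posSemidef_add_sum_abs_smul_one hsym)
      have hΛ₂ : Λ w₂ = 0 := hray w₂ (by rw [hw₂]; exact Matrix.PosSemidef.one.smul hc0)
      have hβw : β w = β w₁ - β w₂ := by rw [hw₁, hw₂, add_sub_cancel_right]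
      rw [hΛw, hβw, map_sub, ← hΛw, ← hΛw, hΛ₁, hΛ₂, sub_zero]
    obtain ⟨w, hw⟩ := hΛ fun _ => 1
    rw [hΛ0] at hw
    have := congrFun hw ⟨0, hn⟩
    simp at this
  -- coordinates adapted to `Λ`
  obtain ⟨R, hR⟩ := Λ.exists_rightInverse_of_surjective (LinearMap.range_eq_top.2 hΛ)
  have hRx : ∀ x, Λ (R x) = x := fun x => by
    have := LinearMap.congr_fun hR x
    simpa using this
  let K : Submodule ℝ (Fin N → ℝ) := LinearMap.ker Λ
  set m : ℕ := Module.finrank ℝ K with hmdef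
  let bK : Module.Basis (Fin m) ℝ K := Module.finBasis ℝ K
  let κ : (Fin m → ℝ) →ₗ[ℝ] (Fin N → ℝ) :=
    Fintype.linearCombination ℝ (fun j => (bK j : Fin N → ℝ))
  have hκ : ∀ u, κ u = ∑ j, u j • (bK j : Fin N → ℝ) := fun u =>
    Fintype.linearCombination_apply _ _ u
  have hκ0 : ∀ u, Λ (κ u) = 0 := fun u => by
    rw [hκ, map_sum]
    exact Finset.sum_eq_zero fun j _ => by rw [map_smul, LinearMap.mem_ker.1 (bK j).2, smul_zero]
  have hdecomp : ∀ w, ∃ u, R (Λ w) + κ u = w := by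
    intro w
    have hv : w - R (Λ w) ∈ K := by
      rw [LinearMap.mem_ker, map_sub, hRx, sub_self]
    refine ⟨bK.repr ⟨w - R (Λ w), hv⟩, ?_⟩
    have hsum : ∑ j, (bK.repr ⟨w - R (Λ w), hv⟩) j • (bK j : Fin N → ℝ) = w - R (Λ w) := by
      have h1 := congrArg Subtype.val (bK.sum_repr ⟨w - R (Λ w), hv⟩)
      rw [Submodule.coe_sum] at h1
      simpa only [Submodule.coe_smul] using h1
    rw [hκ, hsum, add_sub_cancel]
  have hnm : n + m = N := by
    have h1 := LinearMap.finrank_range_add_finrank_ker Λ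
    rw [LinearMap.range_eq_top.2 hΛ, finrank_top, Module.finrank_fin_fun,
      Module.finrank_fin_fun] at h1
    exact h1
  -- the matrices (all symmetric)
  let G₀ : Matrix (Fin k) (Fin k) ℝ := M₁ - β (R a₀)
  let P : Fin n → Matrix (Fin k) (Fin k) ℝ := fun l => β (R fun j => if l = j then 1 else 0)
  let Q : Fin m → Matrix (Fin k) (Fin k) ℝ := fun j => β (κ fun j' => if j = j' then 1 else 0)
  have hβsym : ∀ w, (β w).IsSymm := fun w => ((hDmem _).1 (hβD w)).2
  have hGsym : ∀ r, (Fin.append (Fin.append (fun _ : Fin 1 => G₀) P) Q r).IsSymm := by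
    intro r
    refine Fin.addCases (fun r' => ?_) (fun j => ?_) r
    · refine Fin.addCases (fun o => ?_) (fun l => ?_) r'
      · simp only [Fin.append_left, G₀]
        exact (Matrix.isHermitian_iff_isSymm.1 hM₁.1).sub (hβsym _)
      · simp only [Fin.append_left, Fin.append_right, P]
        exact hβsym _
    · simp only [Fin.append_right, Q]
      exact hβsym _
  have hpen : ∀ (x : Fin n → ℝ) (u : Fin m → ℝ),
      pencil (Fin.append (Fin.append (fun _ : Fin 1 => G₀) P) Q) (coefVec x u) =
        M₁ + β (R (x - a₀) + κ u) := by
    intro x u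
    rw [pencil_append_coefVec]
    have h1 : ∑ l, x l • P l = β (R x) := by
      have := LinearMap.pi_apply_eq_sum_univ (β ∘ₗ R) x
      rw [LinearMap.comp_apply] at this
      rw [this]
      rfl
    have h2 : ∑ j, u j • Q j = β (κ u) := by
      have := LinearMap.pi_apply_eq_sum_univ (β ∘ₗ κ) u
      rw [LinearMap.comp_apply] at this
      rw [this]
      rfl
    rw [h1, h2]
    simp only [G₀, map_add, map_sub]
    abel
  refine ⟨m, Fin.append (Fin.append (fun _ : Fin 1 => G₀) P) Q, by rw [add_assoc, hnm]; exact hcount,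
    hGsym, fun x => ?_⟩
  rw [hC]
  constructor
  · rintro ⟨w, hw, rfl⟩
    obtain ⟨u, hu⟩ := hdecomp w
    refine ⟨u, ?_⟩
    rw [hpen, add_sub_cancel_left, hu]
    exact hw
  · rintro ⟨u, hu⟩
    refine ⟨R (x - a₀) + κ u, ?_, ?_⟩
    · show (M₁ + β (R (x - a₀) + κ u)).PosSemidef
      rw [← hpen]
      exact hu
    · show a₀ + Λ (R (x - a₀) + κ u) = x
      rw [map_add, hRx, hκ0, add_zero, add_sub_cancel]

end SharpNormalForm

section SharpAssembly

variable {n m k v : ℕ}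

/-- **The printed count `nv ≤ |Γ| ≤ d_k²`**: under the hypotheses of Theorem 2.1 (with `n ≥ 1`),
`nv ≤ d_k²` with `d_k = C(k+1, 2) = k(k+1)/2` (the lift data consists of at most `d_k` symmetric
matrices with `d_k` distinct entries each). [cite: GouveiaRobinsonThomas2015, Thm. 2.1 proof (p05)] -/
theorem mul_le_choose_sq (hn : 1 ≤ n) (x : Fin v → (Fin n → ℝ))
    (hind : AlgebraicIndependent ℚ fun p : Fin v × Fin n => x p.1 p.2)
    (hext : ∀ i, x i ∈ (convexHull ℝ (Set.range x)).extremePoints ℝ)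
    (hint : (interior (convexHull ℝ (Set.range x))).Nonempty)
    (hk : HasPsdLift (convexHull ℝ (Set.range x)) k) : n * v ≤ ((k + 1).choose 2) ^ 2 := by
  have hbd : Bornology.IsBounded (convexHull ℝ (Set.range x)) :=
    ((Set.finite_range x).isCompact_convexHull ℝ).isBounded
  obtain ⟨m, G, hcount, hGsym, hmem⟩ := exists_normalForm_symm hk hint hbd hn
  have hinj : Function.Injective x := injective_of_algebraicIndependent hn x hind
  have h𝒰 := isSemialgebraic_liftFamilyS (n := n) (m := m) (k := k)
  have hmem' : ∀ y, Fin.append (encodeS G) y ∈ liftFamilyS n m k ↔ y ∈ convexHull ℝ (Set.range x) :=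
    fun y => by rw [append_mem_liftFamilyS_iff, decodeS_encodeS hGsym, hmem]
  have halg : ∀ i l, IsAlgebraic (paramRing (encodeS G)) (x i l) := by
    intro i l
    obtain ⟨ω, hω⟩ := exists_rat_strict x hinj i (hext i)
    refine isAlgebraic_of_unique_optimum_of_family h𝒰 ω
      ((hmem' _).2 (subset_convexHull ℝ _ ⟨i, rfl⟩))
      (fun y hy => dotRat_le_of_mem_convexHull x i ω hω ((hmem' y).1 hy)) (fun z hz hzmax => ?_) l
    exact eq_of_isMax_dotRat x i ω hω ((hmem' z).1 hz)
      (hzmax (x i) ((hmem' _).2 (subset_convexHull ℝ _ ⟨i, rfl⟩)))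
  have hT : n * v ≤ nParamsS n m k := card_le_of_isAlgebraic_paramRing (encodeS G) x hind halg
  calc n * v ≤ nParamsS n m k := hT
    _ = (1 + n + m) * dSym k := rfl
    _ ≤ dSym k * dSym k := Nat.mul_le_mul_right _ hcount
    _ = ((k + 1).choose 2) ^ 2 := by rw [dSym_eq_choose, sq]

end SharpAssembly

end GenericPsdRank

/-- **Theorem 2.1 with the printed intermediate bound** `nv ≤ |Γ| ≤ d_k²`, `d_k = k(k+1)/2` (p05:
"`Γ` … the set of distinct real entries in the matrices `G_i`. Then `|Γ| ≤ d_k² ≤ k⁴` … Hence, we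
have that `nv ≤ |Γ| ≤ k⁴`"): a generic full-dimensional polytope with `v` vertices in `ℝⁿ` has no psd
lift of size `k` with `C(k+1,2) < √(nv)`. PROVED. [cite: GouveiaRobinsonThomas2015, Thm. 2.1 proof (p05)] -/
theorem GouveiaRobinsonThomas2015_thm21_sharp (n v : ℕ) (x : Fin v → (Fin n → ℝ))
    (hind : AlgebraicIndependent ℚ fun p : Fin v × Fin n => x p.1 p.2)
    (hext : ∀ i, x i ∈ (convexHull ℝ (Set.range x)).extremePoints ℝ)
    (hint : (interior (convexHull ℝ (Set.range x))).Nonempty)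
    (k : ℕ) (hk : HasPsdLift (convexHull ℝ (Set.range x)) k) :
    Real.sqrt (n * v) ≤ (k + 1).choose 2 := by
  rcases Nat.eq_zero_or_pos n with hn0 | hn
  · subst hn0
    rw [Nat.cast_zero, zero_mul, Real.sqrt_zero]
    exact Nat.cast_nonneg _
  · have h := GenericPsdRank.mul_le_choose_sq hn x hind hext hint hk
    have h' : (n : ℝ) * v ≤ (((k + 1).choose 2 : ℕ) : ℝ) ^ 2 := by exact_mod_cast h
    calc Real.sqrt (n * v) ≤ Real.sqrt ((((k + 1).choose 2 : ℕ) : ℝ) ^ 2) := Real.sqrt_le_sqrt h'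
      _ = (k + 1).choose 2 := Real.sqrt_sq (Nat.cast_nonneg _)

end Literature.Combinatorics.Optimization

end
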